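import Summits.AtomisticToContinuum.FouriersLaw.Theses.OddSectorIrreversibility
import Summits.AtomisticToContinuum.FouriersLaw.Theorems.ClosedConeSensitivity.Negative.ZeroFrictionDictionary
import Summits.AtomisticToContinuum.FouriersLaw.Theorems.OddSectorIrreversibilityWitnessGlueClosedFlow
import Summits.AtomisticToContinuum.FouriersLaw.Theorems.OddSectorIrreversibilityWitnessGlueLeak
import Summits.AtomisticToContinuum.FouriersLaw.Theorems.OddSectorIrreversibilityCorrectorTheoryDetFlow
import Summits.AtomisticToContinuum.FouriersLaw.Theorems.OddSectorIrreversibilityCorrectorTheoryTangentCurrent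
import Literature.MathematicalPhysics.KineticTheory.LangevinChainHormander

/-!
# Disproof workfile for crux `TapLeakBound` (P, stmt-AtomisticToContinuum-15159, rank 4 of route OddSectorIrreversibility)

`P`: `∃ a C` with, for all `N`, bonds `i`, contacts `b ∈ {0, N-1}`, the Kubo corrector `u = u_N` of the
OPEN chain (pinned uniquely by `C¹` + a.e.-limit of the finite-horizon correctors) and `0 ≤ s ≤ a·d`:
`|T ∫ ∂_{p_b}u⁺ · ∂_{p_b}(j_i∘Φ_s) e^{-H/T}dqdp| ≤ C √((|⟨u,J⟩_{μ_T}| + Z)·Z) · (1 + d − s/a)^{-3/2}`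
(`Φ_s` = zero-friction kernels = the CLOSED flow `detFlow`; `d` = distance of bond `i` to contact `b`).

## Findings (refuter-cdisprove seat, cycle 1, 2026-08-16 — IN PROGRESS; provers / planner please read)

§0 SHAPE (probe rc 0; `probe_shape`, `tapLeakBound_iff_det`). Honest statement, no junk handle: the
kernel current is `j_i ∘ detFlow s` (`kernelCurrent_eq_currentFlow`), `μT = gibbsWeight`, rpow base
`1 + d − s/a ≥ 1` on the window, `Z > 0`, `u` is pinned uniquely by continuity (independent rattack
seat reached the same reading: item note 10:03Z, ATTACK.md, Slice.lean). Non-vacuous as a theorem: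
`Corrector.correctorCalculus` (tree) inhabits the three hypotheses on `u` for every `N`.

§1 PARITY (all PROVED here, junk-free — change of variables under `Θ(q,p) = (q,−p)` only; proposed to
the Negative lane as `Theorems/TapLeakBound/Negative/TimeParity.lean`, p100935):
 * `pairing_eq_pairing_flip`: the pairing `∫ ∂_b u⁺ · ∂_b g dμ_T` only sees the Θ-EVEN part of `g`;
 * `pairing_eq_zero_of_odd`, `pairing_bondCurrent_eq_zero`: it vanishes on Θ-odd `g`, so the `s = 0`
   slice of `P` is `0 ≤ RHS` for EVERY `u` (hence `d = 0`, `N ≤ 2`, the phantom bond `i = N−1` are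
   content-free; content starts at `N = 3, b = 0, i = 1, 0 < s ≤ a`);
 * `detFlowBack` (`Φ_{−s} := Θ Φ_s Θ`) is the two-sided inverse of `Φ_s` (`detFlow_detFlowBack`,
   `detFlowBack_detFlow`), and `pairing_currentFlow_eq_neg_back`: THE PAIRING IS ODD IN TIME,
   `⟨∂_b u⁺, ∂_b(j_i∘Φ_s)⟩ = −⟨∂_b u⁺, ∂_b(j_i∘Φ_{−s})⟩`: `P` tests only `(j_i∘Φ_s − j_i∘Φ_{−s})/2`,
   whose `p_b`-dependence at distance `d` starts at order `s^{2d+1}` (locality of `A = X_H`): near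
   `s = 0` the pairing is EXTREMELY flat in `s` for far bonds — consistent with the cone, and a warning
   that no `s`-local test can see `P`'s content.

§2 WHERE `P` COULD DIE (assessment). Two independent sufficient routes bracket `P`: (i) tap identity
+ an `L²(Gibbs)` linear TANGENT cone of order 3 (rattack: `P ⇐ TangentBoundAt-poly`; that cone is the
held E3's derivative form, judged false by hot-cluster / tube amplifiers — so (i) is no proof route,
but its failure does NOT refute `P`); (ii) Gaussian IBP `T⟨∂_b f, ∂_b g⟩ = ⟨𝒩_b f, (I−Π_b) g⟩`, then
Cauchy–Schwarz: `P ⇐ H1 ∧ C′` (planner's split). Hence `P` is false only if BOTH fail on one `(d, s)`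
family: (¬C′ at order 3) AND/OR (¬H1: `‖𝒩_b u⁺‖² ≫ N·Z`; generic hypoelliptic smoothing only gives
`N²·Z`, the needed gain is the tap identity's cancellation one derivative higher), PLUS alignment of
`𝒩_b u⁺` with the rare events (no mechanism known either way). The sharpest concrete threat I can
name is a TEMPERATURE effect in C′: a RECEIVER — a hot chaotic cluster sitting at bond `i` — amplifies
the exponentially small precursor `ε ≈ e^{−κ(d − v s)}` of the resampled contact momentum to `O(1)` iff
its gain `e^{λ(e)τ} ≥ 1/ε`, i.e. a FIXED rate threshold `λ(e) ≥ κ(1 − a v)/a` (energy `e ≥ e*(a)`,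
Gibbs price `e^{−e*/T}` independent of `d`) sustained for a lifetime `τ ≍ a d`; with an Arrhenius
lifetime law `τ̄(e) ≍ e^{α e}` the cheapest receiver surviving to `a d` has `e(d) = α⁻¹ log(ad)` and
price `(ad)^{−1/(αT)}`: the capped cone then has a POLYNOMIAL tail of order `m(T) = 1/(αT)` — fat at
HIGH temperature. Order 3 (what `P`/the glue need) fails once `T > 1/(3α)`; the only measured slope
(single-site objects, `ρ = 0.1`, `T = 1–2`, kit j014874/j015061) is `α ≈ 0.08–0.09`, which would put
the threshold near `T ≈ 4`, BELOW the route's diffusive test point `T = 8`. Caveats: multi-site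
cluster lifetimes and the `T`-dependence of `α` are unmeasured (if `τ̄ ≍ e^{c e/T}` — activation
relative to the background — the order is `1/c`, `T`-independent); receivers must be chaotic at the
threshold rate (`λ ≍ 0.05 e^{1/4}` needs `e ≳ (κ(1−av)/(0.05a))⁴`, astronomically hot for small `a`,
so small `a` pushes the danger to enormous `d` — invisible numerically, but `C` is `N`-uniform). The
cheapest decisive measurement for the next seat: the lifetime law `τ̄(e, T)` of planted multi-site
hot clusters at `T = 8` vs `T = 1` (slope in `e` and whether it scales like `1/T`). No constructible
witness for `¬P` exists: every refutation needs the ANHARMONIC corrector `u_N` `N`-uniformly. The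
CONSUMED form of `P` is much safer than `P`: by the ideator-1 covariance identity the contact-summed
leak obeys `|leak_i(s)| ≤ (‖u‖ + s‖J‖/2)·𝔇_i(s)`, `𝔇_i(s)² = E(j_i(X_s) − j_i(Φ_sX_0))²` (open-vs-closed
discrepancy, a CAPPED object, measured below as `D_d(t)`), so the witness line survives `¬P` if the
planner re-types the leak input at E1-scale × discrepancy cone (card stationary-leak-covariance).

§3 NUMERICS — the CONSUMED form of `P`, measured directly (script `plateau_job/main.py` in the seat folder;
jobs: j017159 smoke; j017627 attempt 1 = case B below (then preempted; tables kept in the seat folder as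
`B32_stdout_attempt1.log`); re-split into < 30-min single-config jobs j017886 (A: (1,1,0.1,1) T = 8, N = 32),
j017887 (C: (1,1,1,1) T = 5, N = 32), j017888 (H: harmonic control), j017889 (A, N = 64), j017893 (B, N = 64) —
PENDING at this write; their summaries auto-attach to the item). Estimator: forecast plateau
`ρ_d(t) := ⟨u⁻, j_i∘Φ_t⟩_π / ⟨u, j_i⟩_π` (`= 1 −` leak/(T²D_N); identities `⟨u⁻,g⟩ = ⟨u,g⁻⟩`,
`⟨u_W,f⟩_π = E_π[f(X_0)∫₀^W J(X_r)dr]`; one stationary OPEN trajectory per sample + closed shootings from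
`X_0` and `ΘX_0`), the bond-sum-rule profile `E[j_i R_W]/mean`, and the open-vs-closed discrepancy
`D_d(t) = E(j_i(Φ_tX_0) − j_i(X_t))²/(2⟨j_i²⟩)` (the capped object `𝔇` of card stationary-leak-covariance).
RESULTS 1 — case B = (ω₂,lam,β,γ) = (1,1,1,1), T = 1, N = 32, dt = 0.02, 2.30·10⁶ samples (checks:
⟨p²⟩ = 0.9994, contacts 0.9997; closed-flow |ΔH|/H = 7·10⁻⁵; jackknife errors ≤ 0.01 on every entry):
 (a) `G_ref(W) = E[j_i R_W]` = 2.64 / 4.33 / 5.63 / 5.24 / 5.08 / 4.98 at W = 8/16/32/64/128/256 → `T²D_N ≈ 5.0`,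
     `D_32(T=1) ≈ 5` (quasi-ballistic regime, consistent with the route's `D_N ≍ N` pre-asymptotics at T = 1);
     the BOND SUM RULE of CorrectorTheory is seen converging: profile 0.58…1.20 at W = 16, 0.77…1.07 at W = 32,
     FLAT 0.97…1.03 (±0.02) at W = 128.
 (b) THE FORECAST PLATEAU IS EXACT UP TO THE FRONT: at W = 128, `ρ_d(t) = 1.00 ± 0.01` for all `t ≤ d − 2`
     (d = 4…15), `0.98` at `t = d` (d = 8), then a sharp collapse: `t_{0.9}(d) ≈ d + 1`, `t_{0.5}(d) ≈ d + 4`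
     (d = 2…15: t_{0.5} = 5,7,8,10,11,12,14,15,16,18,19,19,20 for d = 2,4,5,6,…), i.e. a leak FRONT of speed
     `v ≈ 1.0` bond per unit time with an O(1) width; the discrepancy front is the same object
     (`D_d(t) < 0.02` for `t ≤ d`, `D_d = 0.5` at `t ≈ d + 6`). Behind the front `ρ` overshoots to
     `≈ −0.7` at `t ≈ 2d…3d` (closed-chain echo: the isolated chain's current reverses) — irrelevant to `P`.
 (c) READING FOR `P`: in its consumed form (contact-summed, time-integrated) the leak inside the window
     `s ≤ a·d` with `a = 1` is ≤ 1–2 % of `T²D_N` until `d − 2` and ≈ 4–8 % at `s = d`; `P`'s budget there is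
     `γT·C·Z√(1+(N−1)T²D_N)·2a(1 − (1+d)^{−1/2})` ≈ `25·a·C·Z` against a measured `≈ 0.25·Z` — `C ≈ 0.01`
     suffices at N = 32; and the measured profile is far more concentrated at the front than `P`'s
     `(1 + d − s/a)^{−3/2}` (at `s = d/2` `P` allows 17 % of the `s = d` leak; measured ≈ 0 ± 1 %). So at
     T = 1, N = 32 the consumed `P` holds with two orders of magnitude to spare; nothing here threatens the
     line. What plain sampling CANNOT see (as for E3): rare receivers/carriers (§2).
RESULTS 2–5 (jobs j017907 A:32, j017910 A:64, j017908 C:32, j017911 B:64, j017909 H:32; digests in the seat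
folder `RESULTS-all.txt`, attached to the item; 0.23–0.72·10⁶ samples each, ⟨p²⟩ = T to 0.1 %, |ΔH|/H ≤ 1.5·10⁻⁴):
 (d) DIFFUSIVE POINT A = (1,1,0.1,1), T = 8: `T²D_N = 51–54 (N = 32), 56–58 (N = 64)` ⇒ `D_32 ≈ 0.85`, `D_64 ≈ 0.87`
     — the response coefficient is N-INDEPENDENT between 32 and 64 (Fourier-like), against `D_32 = 5.0`,
     `D_64 = 9.1` at the quasi-ballistic point B (T = 1). FORECAST FRONT: `t_{0.5}(d) = 3.04 + 1.69·d` (N = 32)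
     and `3.00 + 1.72·d` (N = 64) — the SAME ballistic law at both sizes, speed `v = 0.59` (= the discrepancy
     front `v_disc = 0.61`; = the harmonic control's 0.58, i.e. the sound speed of the weakly anharmonic
     coupling β = 0.1); pre-front leak `1 − ρ_d(θ·t_{0.5}(d))` = 0 ± 0.03 (θ = ¼, ½; d = 2…9), the plateau
     `ρ_d(t) ≈ 1` holds up to the front at both N; the discrepancy on rays decays EXPONENTIALLY in d at fixed
     θ (`log₁₀ D_d(½t_{0.5}) = −1.3, −1.6, −1.9, …, −6.3` for d = 2…15, ≈ −0.37/bond). So the consumed `P`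
     has an N-UNIFORM window `a < 1/v ≈ 1.7` with a vanishing pre-front leak at the route's own test point —
     exactly the input WitnessGlue needs; typical dynamics gives no hint of failure.
 (e) TEMPERATURE: C = (1,1,1,1), T = 5, N = 32: `D_32 ≈ 5.9`, front `t_{0.5} = 1.8 + 0.89·d` (`v ≈ 1.12`, faster
     than at T = 1 (≈ 1.0) and than harmonic sound (0.62): anharmonic stiffening), pre-front leak 0 ± 0.02.
     No fattening of the pre-front leak with T is visible at these sample sizes (the receiver scenario of §2
     lives in the far tail, invisible to 10⁵–10⁶ plain samples, as predicted).
 (f) SIZE at T = 1: B, N = 64: `T²D_64 ≈ 9.1` (vs 5.0 at N = 32: `D_N ∝ N^{0.85}`, quasi-ballistic as the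
     route header warns for (1,1,1,1), T = 1), front `t_{0.5} = 2.5 + 1.27·d`, plateau intact below it.
 (g) HARMONIC CONTROL H, N = 32: `v = 0.58` (maximal group velocity 0.62 ✓), `D_32 = 4.1`, clean cone with
     super-exponential tail — the estimator and the code are validated.
 NUMERICS VERDICT: every measurable feature of the CONSUMED form of `P` (plateau to the front, ballistic
 N-independent front, exponentially small pre-front discrepancy, flat bond sum rule) holds at the diffusive
 point for N = 32, 64 and at T = 1, 5, 8; the typed `P`'s surplus (per-contact rate, far contact, √tap
 prefactor) and the rare-event tails are beyond plain sampling. No numerical kill; the line's physical bet is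
 supported; the open risk is entirely in the N-uniform TAILS (§2).

§4 LOAD-BEARING HYPOTHESES — PROVED (`tapLeakBound_false_without_corrector`, namespace `N3`;
proposed to the Negative lane as `Theorems/TapLeakBound/Negative/FalseWithoutCorrector.lean`): the
corrector hypothesis (a.e.-limit clause) is load-bearing — `P` with that clause deleted (every
`u ∈ C¹ ∩ L²(μ_T)`, all else verbatim: `N3.TapLeakPairingBoundFreeAt`) is FALSE, for EVERY `a > 0` and
EVERY `C`, already at `(ω₂,lam,β,γ) = (1,1,1,1)`, `T = 1` (`N3.not_tapLeakPairingBoundFreeAt`). Mechanism: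
LHS is degree-1 homogeneous in `u`, RHS degree ½, so ONE admissible instance with non-zero pairing
suffices; by §1 only the time-antisymmetric part of `j_i∘Φ_s` is tested, whose `p_0`-dependence at the
nearest admissible bond (`N = 3`, `b = 0`, `i = 1`, `d = 1`, `0 < s ≤ a`) starts at ORDER `s³` — the
kernel-checked third-order fact `N3.exists_window_Psi_j1_ne_zero`: with `x₀ = ((−1,0,1),0)`,
`x₁ = x₀ + e_{p_0}`, `Ψ(s) = (j_1(Φ_s x₁) + j_1(Φ_s Θx₁))/2 − j_1(Φ_s x₀)` has `Ψ = Ψ′ = Ψ″ = 0` at `0`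
and `Ψ‴(0) = 6` (explicit `A j_1`, `A² j_1`, and `(A³j_1)(x₀) = −128`, `(A³j_1)(x₁) = (A³j_1)(Θx₁) = −122`;
`6 = ½V′(r_1)V‴(r_0)` is purely anharmonic); then MVT ⇒ `∂_{p_0}w_s ≢ 0` for
`w_s = (j_1∘Φ_s + j_1∘Φ_s∘Θ)/2`, the pairing of `w_s` with `j_1∘Φ_s` equals `‖∂_{p_0}w_s‖²_{L²(μ_T)} > 0`
(`N3.pairing_w_cf_eq`, `N3.integral_sq_partialP_w_pos`), `∫ w_s J dμ_T = 0`, and `u = M·w_s` beats any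
`C`. READING FOR PROVERS: every proof of `P` must extract the `√(|⟨u,J⟩| + Z)` normalisation from
`L u = −J` (tap identity / Hermite structure / H1); nothing valid for general smooth `u` reaches `P`.
Quantitative by-product: at `d = 1` the pairing is `O(s³)`, for a bond at distance `d` it is
`O(s^{2d+1})` — `P` is trivially true in a boundary layer `s ≪ 1` of the window and its content is at
`s ≍ d`. `ContDiff ℝ 1 u`: not decoration (blocks junk-`deriv` attacks; rattack); `MemLp u 2`:
redundant given the other two (rattack).

-- Targets: none (payload.targets = []; no line picked).
-/

noncomputable section
set_option linter.unusedSimpArgs false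

namespace Summit.AtomisticToContinuum.FouriersLaw.Cruxes.TapLeakBound.Disproof

open MeasureTheory Filter Topology ProbabilityTheory Set
open scoped NNReal ENNReal
open Literature.MathematicalPhysics.KineticTheory.HeatConduction
open Summit.AtomisticToContinuum.FouriersLaw.Theses.OddSectorIrreversibility
open Summit.AtomisticToContinuum.FouriersLaw.Theorems.ClosedConeSensitivity.Negative.ZeroFrictionDictionary
open Summit.AtomisticToContinuum.FouriersLaw.Theorems.OddSectorWitness

/-! ## §0 the crux, verbatim, and read through the zero-friction dictionary -/

/-- The crux elaborates and has the displayed shape (refuter probe, rc 0). -/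
theorem probe_shape : TapLeakBound ↔
    ∀ ω₂ lam β γ : ℝ, 0 < ω₂ → 0 < lam → 0 < β → 0 < γ → ∀ T : ℝ, 0 < T → ∃ a C : ℝ, 0 < a ∧ ∀ (N : ℕ) (i b : Fin N) (u : Literature.MathematicalPhysics.KineticTheory.HeatConduction.PhaseSpace N → ℝ) (s : ℝ), (b.val = 0 ∨ b.val = N - 1) → 0 ≤ s → let P := Literature.MathematicalPhysics.KineticTheory.HeatConduction.pinnedChain ω₂ lam β γ; let P₀ := Literature.MathematicalPhysics.KineticTheory.HeatConduction.pinnedChain ω₂ lam β 0; let μT : MeasureTheory.Measure (Literature.MathematicalPhysics.KineticTheory.HeatConduction.PhaseSpace N) := MeasureTheory.volume.withDensity (fun x : Literature.MathematicalPhysics.KineticTheory.HeatConduction.PhaseSpace N => ENNReal.ofReal (Real.exp (-(P.hamiltonian N x) / T))); let J : Literature.MathematicalPhysics.KineticTheory.HeatConduction.PhaseSpace N → ℝ := fun z => ∑ k : Fin N, P.bondCurrent N k z; let ue : Literature.MathematicalPhysics.KineticTheory.HeatConduction.PhaseSpace N → ℝ := fun x => (u x + u (x.1, -x.2)) / 2;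 let js : Literature.MathematicalPhysics.KineticTheory.HeatConduction.PhaseSpace N → ℝ := fun x => ∫ y, P.bondCurrent N i y ∂(P₀.transitionKernel N T T s.toNNReal x); let d : ℕ := (if b.val = 0 then i.val else N - 2 - i.val); ContDiff ℝ 1 u → MeasureTheory.MemLp u 2 μT → (∀ᵐ x ∂μT, Filter.Tendsto (fun τ : ℝ => ∫ t in Set.Ioc (0 : ℝ) τ, (∫ y, J y ∂(P.transitionKernel N T T t.toNNReal x))) Filter.atTop (nhds (u x))) → s ≤ a * (d : ℝ) → |T * ∫ x, Literature.MathematicalPhysics.KineticTheory.HeatConduction.partialP b ue x * Literature.MathematicalPhysics.KineticTheory.HeatConduction.partialP b js x ∂μT| ≤ C * Real.sqrt ((|∫ x, u x * J x ∂μT| + ∫ x, Real.exp (-(P.hamiltonian N x) / T) ∂MeasureTheory.volume) * ∫ x, Real.exp (-(P.hamiltonian N x) / T) ∂MeasureTheory.volume) / (1 + ((d : ℝ) - s / a)) ^ (3 / 2 : ℝ) :=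
  Iff.rfl

/-- The even part `u⁺ = (u + u∘Θ)/2` of an observable, spelled as in the crux. -/
def evenPart {N : ℕ} (u : PhaseSpace N → ℝ) : PhaseSpace N → ℝ := fun x => (u x + u (x.1, -x.2)) / 2

/-- The closed-flow transported bond current `g_s = j_i ∘ Φ_s` (`Φ = detFlow`, the flow behind the
zero-friction kernels). -/
def currentFlow (ω₂ lam β : ℝ) (N : ℕ) (i : Fin N) (s : ℝ) : PhaseSpace N → ℝ :=
  fun x => (pinnedChain ω₂ lam β 0).bondCurrent N i (detFlow ω₂ lam β N s x)

/-- The tap-leak pairing of `P` at contact `b` (without the factor `T`):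
`∫ ∂_{p_b} u⁺ · ∂_{p_b} g dμ_T`. -/
def pairing (ω₂ lam β γ T : ℝ) (N : ℕ) (b : Fin N) (u g : PhaseSpace N → ℝ) : ℝ :=
  ∫ x, partialP b (evenPart u) x * partialP b g x ∂(gibbsWeight ω₂ lam β γ N T)

/-- `P` read through the dictionary: the kernel average `js` IS `j_i ∘ Φ_s` and `μT` is `gibbsWeight`,
so the crux is a statement about `pairing … b u (currentFlow … i s)`. -/
def TapLeakBoundDet : Prop :=
  ∀ ω₂ lam β γ : ℝ, 0 < ω₂ → 0 < lam → 0 < β → 0 < γ → ∀ T : ℝ, 0 < T → ∃ a C : ℝ, 0 < a ∧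
    ∀ (N : ℕ) (i b : Fin N) (u : PhaseSpace N → ℝ) (s : ℝ), (b.val = 0 ∨ b.val = N - 1) → 0 ≤ s →
      let P := pinnedChain ω₂ lam β γ
      let μT : Measure (PhaseSpace N) := gibbsWeight ω₂ lam β γ N T
      let J : PhaseSpace N → ℝ := fun z => ∑ k : Fin N, P.bondCurrent N k z
      let d : ℕ := (if b.val = 0 then i.val else N - 2 - i.val)
      ContDiff ℝ 1 u → MemLp u 2 μT →
      (∀ᵐ x ∂μT, Tendsto (fun τ : ℝ => ∫ t in Set.Ioc (0 : ℝ) τ,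
          (∫ y, J y ∂(P.transitionKernel N T T t.toNNReal x))) atTop (nhds (u x))) →
      s ≤ a * (d : ℝ) →
        |T * pairing ω₂ lam β γ T N b u (currentFlow ω₂ lam β N i s)|
          ≤ C * Real.sqrt ((|∫ x, u x * J x ∂μT| + ∫ x, Real.exp (-(P.hamiltonian N x) / T) ∂volume) *
              ∫ x, Real.exp (-(P.hamiltonian N x) / T) ∂volume) / (1 + ((d : ℝ) - s / a)) ^ (3 / 2 : ℝ)

section ParityDict
variable {ω₂ lam β : ℝ} (hω : 0 < ω₂) (hl : 0 ≤ lam) (hβ : 0 ≤ β)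
include hω hl hβ

/-- The kernel average of the crux is the closed-flow transported current. -/
theorem kernelCurrent_eq_currentFlow (γ : ℝ) (N : ℕ) (i : Fin N) (T : ℝ) {s : ℝ} (hs : 0 ≤ s)
    (x : PhaseSpace N) :
    (∫ y, (pinnedChain ω₂ lam β γ).bondCurrent N i y ∂((pinnedChain ω₂ lam β 0).transitionKernel N T T s.toNNReal x)) =
      currentFlow ω₂ lam β N i s x := by
  rw [integral_transitionKernel_zero_friction hω hl hβ]
  simp only [currentFlow, bondCurrent_indep_friction, Real.coe_toNNReal _ hs]

omit hω hl hβ in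
/-- **Dictionary.** `P` is literally `TapLeakBoundDet`. -/
theorem tapLeakBound_iff_det : TapLeakBound ↔ TapLeakBoundDet := by
  unfold TapLeakBound TapLeakBoundDet
  constructor
  · intro h ω₂ lam β γ hω hl hβ hγ T hT
    obtain ⟨a, C, ha, H⟩ := h ω₂ lam β γ hω hl hβ hγ T hT
    refine ⟨a, C, ha, fun N i b u s hb hs => ?_⟩
    have H' := H N i b u s hb hs
    have hfun : (fun x => ∫ y, (pinnedChain ω₂ lam β γ).bondCurrent N i y
        ∂((pinnedChain ω₂ lam β 0).transitionKernel N T T s.toNNReal x)) = currentFlow ω₂ lam β N i s :=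
      funext fun x => kernelCurrent_eq_currentFlow hω hl.le hβ.le γ N i T hs x
    simp only [hfun] at H'
    exact H'
  · intro h ω₂ lam β γ hω hl hβ hγ T hT
    obtain ⟨a, C, ha, H⟩ := h ω₂ lam β γ hω hl hβ hγ T hT
    refine ⟨a, C, ha, fun N i b u s hb hs => ?_⟩
    have H' := H N i b u s hb hs
    have hfun : (fun x => ∫ y, (pinnedChain ω₂ lam β γ).bondCurrent N i y
        ∂((pinnedChain ω₂ lam β 0).transitionKernel N T T s.toNNReal x)) = currentFlow ω₂ lam β N i s :=
      funext fun x => kernelCurrent_eq_currentFlow hω hl.le hβ.le γ N i T hs x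
    simp only [hfun]
    exact H'


/-! ## §1 parity: the pairing only sees the Θ-even part of the transported current, is ODD in
time, and vanishes identically at `s = 0` (for EVERY `u`, corrector or not) -/

omit hω hl hβ in
/-- The even part is even. -/
theorem evenPart_flip {N : ℕ} (u : PhaseSpace N → ℝ) (x : PhaseSpace N) :
    evenPart u (x.1, -x.2) = evenPart u x := by
  simp only [evenPart, neg_neg, Prod.mk.eta]
  ring

omit hω hl hβ in
/-- `∂_{p_b} u⁺` is Θ-odd (no differentiability needed). -/
theorem partialP_evenPart_flip {N : ℕ} (u : PhaseSpace N → ℝ) (b : Fin N) (x : PhaseSpace N) :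
    partialP b (evenPart u) (x.1, -x.2) = -partialP b (evenPart u) x := by
  have h := partialP_comp_momentumReversal N (evenPart u) b x
  have hfun : (fun y : PhaseSpace N => evenPart u (y.1, -y.2)) = evenPart u := funext fun y => evenPart_flip u y
  rw [hfun] at h
  linarith

omit hω hl hβ in
/-- `∂_{p_b}(-g) = -∂_{p_b} g` (no differentiability needed). -/
theorem partialP_neg' {N : ℕ} (b : Fin N) (g : PhaseSpace N → ℝ) (x : PhaseSpace N) :
    partialP b (fun y => -g y) x = -partialP b g x := by
  unfold partialP
  exact deriv.neg

omit hω hl hβ in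
/-- **Parity of the pairing.** For EVERY `u` and EVERY `g` (no regularity, no integrability: a
change of variables under the momentum reversal, which preserves `μ_T`, and `∂_b(g∘Θ) = -(∂_b g)∘Θ`):
`∫ ∂_b u⁺ · ∂_b g dμ_T = ∫ ∂_b u⁺ · ∂_b (g∘Θ) dμ_T`. In words: the pairing of `P` only sees
the Θ-even part `(g + g∘Θ)/2` of the transported current — for `g = j_i∘Φ_s` that is the
TIME-ANTISYMMETRIC part `(j_i∘Φ_s − j_i∘Φ_{−s})/2`. -/
theorem pairing_eq_pairing_flip (γ T : ℝ) (N : ℕ) (b : Fin N) (u g : PhaseSpace N → ℝ) :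
    pairing ω₂ lam β γ T N b u g = pairing ω₂ lam β γ T N b u (fun y => g (y.1, -y.2)) := by
  unfold pairing
  rw [← integral_comp_momentumReversal_gibbsWeight (ω₂ := ω₂) (lam := lam) (β := β) γ N T
    (fun x => partialP b (evenPart u) x * partialP b g x)]
  refine integral_congr_ae (Eventually.of_forall fun x => ?_)
  have h1 := partialP_evenPart_flip u b x
  have h2 := partialP_comp_momentumReversal N g b x
  simp only [h1, h2]
  ring

omit hω hl hβ in
/-- **The pairing against a Θ-odd observable vanishes** — in particular against every bond
current `j_i` itself (`s = 0`), for EVERY `u`. -/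
theorem pairing_eq_zero_of_odd (γ T : ℝ) (N : ℕ) (b : Fin N) (u g : PhaseSpace N → ℝ)
    (hodd : ∀ y, g (y.1, -y.2) = -g y) : pairing ω₂ lam β γ T N b u g = 0 := by
  unfold pairing
  set F : PhaseSpace N → ℝ := fun x => partialP b (evenPart u) x * partialP b g x with hF
  have hflip : ∀ x, F (x.1, -x.2) = -F x := fun x => by
    have h1 := partialP_evenPart_flip u b x
    have hg : partialP b g (x.1, -x.2) = partialP b g x := by
      have h3 := partialP_comp_momentumReversal N g b x
      have hfun' : (fun y : PhaseSpace N => g (y.1, -y.2)) = fun y => -g y := funext hodd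
      rw [hfun', partialP_neg'] at h3
      linarith
    simp only [hF, h1, hg]
    ring
  have hI := integral_comp_momentumReversal_gibbsWeight (ω₂ := ω₂) (lam := lam) (β := β) γ N T F
  simp only [hflip, integral_neg] at hI
  show ∫ x, F x ∂(gibbsWeight ω₂ lam β γ N T) = 0
  linarith

omit hω hl hβ in
/-- `s = 0`: the pairing of `P` against the static current vanishes for every `u`, every bond,
every contact, every `N` (`j_i` is odd in the momenta). -/
theorem pairing_bondCurrent_eq_zero (γ γ' T : ℝ) (N : ℕ) (i b : Fin N) (u : PhaseSpace N → ℝ) :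
    pairing ω₂ lam β γ T N b u ((pinnedChain ω₂ lam β γ').bondCurrent N i) = 0 :=
  pairing_eq_zero_of_odd γ T N b u _ fun y => OscillatorChain.bondCurrent_neg_momentum _ N i y

/-- The backward closed flow `Φ_{-s} := Θ ∘ Φ_s ∘ Θ` (`s ≥ 0`). -/
def detFlowBack (ω₂ lam β : ℝ) (N : ℕ) (s : ℝ) (x : PhaseSpace N) : PhaseSpace N :=
  ((detFlow ω₂ lam β N s (x.1, -x.2)).1, -(detFlow ω₂ lam β N s (x.1, -x.2)).2)

/-- `Φ_s ∘ Φ_{-s} = id` (time reversal of the Hamiltonian flow). -/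
theorem detFlow_detFlowBack (N : ℕ) {s : ℝ} (hs : 0 ≤ s) (x : PhaseSpace N) :
    detFlow ω₂ lam β N s (detFlowBack ω₂ lam β N s x) = x := by
  unfold detFlowBack
  have h := Summit.AtomisticToContinuum.FouriersLaw.Theorems.OddSectorIrreversibility.Corrector.detFlow_reversal
    hω hl hβ N ((x.1, -x.2) : PhaseSpace N) hs
  simpa using h

/-- `Φ_{-s} ∘ Φ_s = id`. -/
theorem detFlowBack_detFlow (N : ℕ) {s : ℝ} (hs : 0 ≤ s) (x : PhaseSpace N) :
    detFlowBack ω₂ lam β N s (detFlow ω₂ lam β N s x) = x := by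
  unfold detFlowBack
  have h := Summit.AtomisticToContinuum.FouriersLaw.Theorems.OddSectorIrreversibility.Corrector.detFlow_reversal
    hω hl hβ N x hs
  rw [h]
  simp

/-- The backward-transported bond current `j_i ∘ Φ_{-s}`. -/
def currentFlowBack (ω₂ lam β : ℝ) (N : ℕ) (i : Fin N) (s : ℝ) : PhaseSpace N → ℝ :=
  fun x => (pinnedChain ω₂ lam β 0).bondCurrent N i (detFlowBack ω₂ lam β N s x)

omit hω hl hβ in
/-- `(j_i∘Φ_s)(Θx) = -(j_i∘Φ_{-s})(x)`. -/
theorem currentFlow_flip (N : ℕ) (i : Fin N) (s : ℝ) (x : PhaseSpace N) :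
    currentFlow ω₂ lam β N i s (x.1, -x.2) = -currentFlowBack ω₂ lam β N i s x := by
  unfold currentFlow currentFlowBack detFlowBack
  rw [← OscillatorChain.bondCurrent_neg_momentum]
  simp

omit hω hl hβ in
/-- `pairing` is odd in its second slot (junk-free: `∂_b(-f) = -∂_b f`, `∫(-F) = -∫F`). -/
theorem pairing_neg (γ T : ℝ) (N : ℕ) (b : Fin N) (u g : PhaseSpace N → ℝ) :
    pairing ω₂ lam β γ T N b u (fun y => -g y) = -pairing ω₂ lam β γ T N b u g := by
  unfold pairing
  rw [← integral_neg]
  refine integral_congr_ae (Eventually.of_forall fun x => ?_)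
  simp only [partialP_neg']
  ring

omit hω hl hβ in
/-- **The pairing is odd in time**: `⟨∂_b u⁺, ∂_b(j_i∘Φ_s)⟩_{μ_T} = -⟨∂_b u⁺, ∂_b(j_i∘Φ_{-s})⟩_{μ_T}`
for every `u`, `s ≥ 0` (junk-free). -/
theorem pairing_currentFlow_eq_neg_back (γ T : ℝ) (N : ℕ) (i b : Fin N) (u : PhaseSpace N → ℝ) (s : ℝ) :
    pairing ω₂ lam β γ T N b u (currentFlow ω₂ lam β N i s) =
      -pairing ω₂ lam β γ T N b u (currentFlowBack ω₂ lam β N i s) := by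
  rw [pairing_eq_pairing_flip]
  have hfun : (fun y : PhaseSpace N => currentFlow ω₂ lam β N i s (y.1, -y.2)) =
      fun y => -currentFlowBack ω₂ lam β N i s y := funext fun y => currentFlow_flip N i s y
  rw [hfun, pairing_neg]


/-! ## §4 LOAD-BEARING ANALYSIS (cdisprove protocol (a)): `P` without the corrector hypothesis is FALSE.
The development below is proposed verbatim to the Negative lane as
`Theorems/TapLeakBound/Negative/FalseWithoutCorrector.lean`; once landed, this section is to be replaced by an import. -/

end ParityDict

namespace N3
open scoped ContDiff
open Literature.MathematicalPhysics.KineticTheory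
open Summit.AtomisticToContinuum.FouriersLaw.Theorems.SuperadditiveResistance.DeviceLiouville



section upd
variable {α : Type*} (f : Fin 3 → α) (t : α)
/-- `upd01` (explicit computation / helper for the third-order witness). [folklore] -/
@[simp] theorem upd01 : Function.update f 0 t 1 = f 1 := Function.update_of_ne (by decide) _ _
/-- `upd02` (explicit computation / helper for the third-order witness). [folklore] -/
@[simp] theorem upd02 : Function.update f 0 t 2 = f 2 := Function.update_of_ne (by decide) _ _
/-- `upd10` (explicit computation / helper for the third-order witness). [folklore] -/
@[simp] theorem upd10 : Function.update f 1 t 0 = f 0 := Function.update_of_ne (by decide) _ _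
/-- `upd12` (explicit computation / helper for the third-order witness). [folklore] -/
@[simp] theorem upd12 : Function.update f 1 t 2 = f 2 := Function.update_of_ne (by decide) _ _
/-- `upd20` (explicit computation / helper for the third-order witness). [folklore] -/
@[simp] theorem upd20 : Function.update f 2 t 0 = f 0 := Function.update_of_ne (by decide) _ _
/-- `upd21` (explicit computation / helper for the third-order witness). [folklore] -/
@[simp] theorem upd21 : Function.update f 2 t 1 = f 1 := Function.update_of_ne (by decide) _ _
end upd

/-- `deriv_const_sub_self` (explicit computation / helper for the third-order witness). [folklore] -/
theorem deriv_const_sub_self (c x : ℝ) : deriv (fun t => c - t) x = -1 := by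
  rw [deriv_const_sub, deriv_id'']
/-- `deriv_const_sub_self'` (explicit computation / helper for the third-order witness). [folklore] -/
theorem deriv_const_sub_self' (c x : ℝ) : deriv (HSub.hSub c) x = -1 := deriv_const_sub_self c x
/-- `deriv_const_add_self` (explicit computation / helper for the third-order witness). [folklore] -/
theorem deriv_const_add_self (c x : ℝ) : deriv (fun t => c + t) x = 1 := by
  rw [deriv_const_add, deriv_id'']
/-- `deriv_const_add_self'` (explicit computation / helper for the third-order witness). [folklore] -/
theorem deriv_const_add_self' (c x : ℝ) : deriv (HAdd.hAdd c) x = 1 := deriv_const_add_self c x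
/-- `deriv_const_mul_self'` (explicit computation / helper for the third-order witness). [folklore] -/
theorem deriv_const_mul_self' (c x : ℝ) : deriv (HMul.hMul c) x = c := deriv_const_mul_id c


/-- the pinned anharmonic 3-chain with ω₂ = lam = β = 1 [folklore] -/
abbrev P3 (γ : ℝ) : OscillatorChain := pinnedChain 1 1 1 γ

/-- explicit middle-bond current j_1 [folklore] -/
def j1 (x : PhaseSpace 3) : ℝ :=
  -((x.2 1 + x.2 2) / 2 * ((x.1 2 - x.1 1) + (x.1 2 - x.1 1) ^ 3))

/-- `bondCurrent_one_eq` (explicit computation / helper for the third-order witness). [folklore] -/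
theorem bondCurrent_one_eq (γ : ℝ) : (P3 γ).bondCurrent 3 1 = j1 := by
  funext x
  simp [OscillatorChain.bondCurrent, Fin.sum_univ_three, pinnedChain_deriv_V, j1]

/-- the three forces [folklore] -/
theorem partialQ0_H (γ : ℝ) (x : PhaseSpace 3) :
    partialQ 0 ((P3 γ).hamiltonian 3) x = (x.1 0 + x.1 0 ^ 3) - ((x.1 1 - x.1 0) + (x.1 1 - x.1 0) ^ 3) := by
  rw [OscillatorChain.partialQ_hamiltonian_eq_dPotential _
    ((pinnedChain_contDiff_U 1 1 1 γ (n := 1)).differentiable one_ne_zero)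
    ((pinnedChain_contDiff_V 1 1 1 γ (n := 1)).differentiable one_ne_zero)]
  simp [OscillatorChain.dPotential, Fin.sum_univ_three, pinnedChain_deriv_U, pinnedChain_deriv_V]
  all_goals ring_nf

/-- `partialQ1_H` (explicit computation / helper for the third-order witness). [folklore] -/
theorem partialQ1_H (γ : ℝ) (x : PhaseSpace 3) :
    partialQ 1 ((P3 γ).hamiltonian 3) x =
      (x.1 1 + x.1 1 ^ 3) + ((x.1 1 - x.1 0) + (x.1 1 - x.1 0) ^ 3) - ((x.1 2 - x.1 1) + (x.1 2 - x.1 1) ^ 3) := by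
  rw [OscillatorChain.partialQ_hamiltonian_eq_dPotential _
    ((pinnedChain_contDiff_U 1 1 1 γ (n := 1)).differentiable one_ne_zero)
    ((pinnedChain_contDiff_V 1 1 1 γ (n := 1)).differentiable one_ne_zero)]
  simp [OscillatorChain.dPotential, Fin.sum_univ_three, pinnedChain_deriv_U, pinnedChain_deriv_V]
  all_goals ring_nf

/-- `partialQ2_H` (explicit computation / helper for the third-order witness). [folklore] -/
theorem partialQ2_H (γ : ℝ) (x : PhaseSpace 3) :
    partialQ 2 ((P3 γ).hamiltonian 3) x =
      (x.1 2 + x.1 2 ^ 3) + ((x.1 2 - x.1 1) + (x.1 2 - x.1 1) ^ 3) := by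
  rw [OscillatorChain.partialQ_hamiltonian_eq_dPotential _
    ((pinnedChain_contDiff_U 1 1 1 γ (n := 1)).differentiable one_ne_zero)
    ((pinnedChain_contDiff_V 1 1 1 γ (n := 1)).differentiable one_ne_zero)]
  simp [OscillatorChain.dPotential, Fin.sum_univ_three, pinnedChain_deriv_U, pinnedChain_deriv_V]

/-! level 1: partials of j1 and the closed form of A j1 -/

theorem partialQ0_j1 (x : PhaseSpace 3) : partialQ 0 j1 x = 0 := by
  unfold partialQ j1
  simp only [Function.update_self, upd01, upd02, upd10, upd12, upd20, upd21,
    Matrix.cons_val_zero, Matrix.cons_val_one, Matrix.head_cons, Matrix.cons_val_two, Matrix.tail_cons]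
  simp (disch := fun_prop) only [deriv_fun_add, deriv_fun_sub, deriv_fun_mul,
    deriv_fun_pow, deriv.fun_neg, deriv_const, deriv_id'', deriv_const_mul_field, deriv_mul_const_field, deriv_div_const,
    deriv_sub_const, deriv_const_sub, deriv_add_const, deriv_const_add, deriv_const_sub_self, deriv_const_sub_self',
    deriv_const_add_self, deriv_const_add_self', deriv_const_mul_self', deriv_const_mul_id, deriv_neg,
    Nat.cast_ofNat, one_mul, mul_one]
  all_goals ring_nf
/-- `partialQ1_j1` (explicit computation / helper for the third-order witness). [folklore] -/
theorem partialQ1_j1 (x : PhaseSpace 3) :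
    partialQ 1 j1 x = (x.2 1 + x.2 2) / 2 * (1 + 3 * (x.1 2 - x.1 1) ^ 2) := by
  unfold partialQ j1
  simp only [Function.update_self, upd01, upd02, upd10, upd12, upd20, upd21,
    Matrix.cons_val_zero, Matrix.cons_val_one, Matrix.head_cons, Matrix.cons_val_two, Matrix.tail_cons]
  simp (disch := fun_prop) only [deriv_fun_add, deriv_fun_sub, deriv_fun_mul,
    deriv_fun_pow, deriv.fun_neg, deriv_const, deriv_id'', deriv_const_mul_field, deriv_mul_const_field, deriv_div_const,
    deriv_sub_const, deriv_const_sub, deriv_add_const, deriv_const_add, deriv_const_sub_self, deriv_const_sub_self',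
    deriv_const_add_self, deriv_const_add_self', deriv_const_mul_self', deriv_const_mul_id, deriv_neg,
    Nat.cast_ofNat, one_mul, mul_one]
  all_goals ring_nf
/-- `partialQ2_j1` (explicit computation / helper for the third-order witness). [folklore] -/
theorem partialQ2_j1 (x : PhaseSpace 3) :
    partialQ 2 j1 x = -((x.2 1 + x.2 2) / 2 * (1 + 3 * (x.1 2 - x.1 1) ^ 2)) := by
  unfold partialQ j1
  simp only [Function.update_self, upd01, upd02, upd10, upd12, upd20, upd21,
    Matrix.cons_val_zero, Matrix.cons_val_one, Matrix.head_cons, Matrix.cons_val_two, Matrix.tail_cons]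
  simp (disch := fun_prop) only [deriv_fun_add, deriv_fun_sub, deriv_fun_mul,
    deriv_fun_pow, deriv.fun_neg, deriv_const, deriv_id'', deriv_const_mul_field, deriv_mul_const_field, deriv_div_const,
    deriv_sub_const, deriv_const_sub, deriv_add_const, deriv_const_add, deriv_const_sub_self, deriv_const_sub_self',
    deriv_const_add_self, deriv_const_add_self', deriv_const_mul_self', deriv_const_mul_id, deriv_neg,
    Nat.cast_ofNat, one_mul, mul_one]
  all_goals ring_nf
/-- `partialP0_j1` (explicit computation / helper for the third-order witness). [folklore] -/
theorem partialP0_j1 (x : PhaseSpace 3) : partialP 0 j1 x = 0 := by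
  unfold partialP j1
  simp only [Function.update_self, upd01, upd02, upd10, upd12, upd20, upd21,
    Matrix.cons_val_zero, Matrix.cons_val_one, Matrix.head_cons, Matrix.cons_val_two, Matrix.tail_cons]
  simp (disch := fun_prop) only [deriv_fun_add, deriv_fun_sub, deriv_fun_mul,
    deriv_fun_pow, deriv.fun_neg, deriv_const, deriv_id'', deriv_const_mul_field, deriv_mul_const_field, deriv_div_const,
    deriv_sub_const, deriv_const_sub, deriv_add_const, deriv_const_add, deriv_const_sub_self, deriv_const_sub_self',
    deriv_const_add_self, deriv_const_add_self', deriv_const_mul_self', deriv_const_mul_id, deriv_neg,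
    Nat.cast_ofNat, one_mul, mul_one]
  all_goals ring_nf
/-- `partialP1_j1` (explicit computation / helper for the third-order witness). [folklore] -/
theorem partialP1_j1 (x : PhaseSpace 3) :
    partialP 1 j1 x = -(((x.1 2 - x.1 1) + (x.1 2 - x.1 1) ^ 3) / 2) := by
  unfold partialP j1
  simp only [Function.update_self, upd01, upd02, upd10, upd12, upd20, upd21,
    Matrix.cons_val_zero, Matrix.cons_val_one, Matrix.head_cons, Matrix.cons_val_two, Matrix.tail_cons]
  simp (disch := fun_prop) only [deriv_fun_add, deriv_fun_sub, deriv_fun_mul,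
    deriv_fun_pow, deriv.fun_neg, deriv_const, deriv_id'', deriv_const_mul_field, deriv_mul_const_field, deriv_div_const,
    deriv_sub_const, deriv_const_sub, deriv_add_const, deriv_const_add, deriv_const_sub_self, deriv_const_sub_self',
    deriv_const_add_self, deriv_const_add_self', deriv_const_mul_self', deriv_const_mul_id, deriv_neg,
    Nat.cast_ofNat, one_mul, mul_one]
  all_goals ring_nf
/-- `partialP2_j1` (explicit computation / helper for the third-order witness). [folklore] -/
theorem partialP2_j1 (x : PhaseSpace 3) :
    partialP 2 j1 x = -(((x.1 2 - x.1 1) + (x.1 2 - x.1 1) ^ 3) / 2) := by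
  unfold partialP j1
  simp only [Function.update_self, upd01, upd02, upd10, upd12, upd20, upd21,
    Matrix.cons_val_zero, Matrix.cons_val_one, Matrix.head_cons, Matrix.cons_val_two, Matrix.tail_cons]
  simp (disch := fun_prop) only [deriv_fun_add, deriv_fun_sub, deriv_fun_mul,
    deriv_fun_pow, deriv.fun_neg, deriv_const, deriv_id'', deriv_const_mul_field, deriv_mul_const_field, deriv_div_const,
    deriv_sub_const, deriv_const_sub, deriv_add_const, deriv_const_add, deriv_const_sub_self, deriv_const_sub_self',
    deriv_const_add_self, deriv_const_add_self', deriv_const_mul_self', deriv_const_mul_id, deriv_neg,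
    Nat.cast_ofNat, one_mul, mul_one]
  all_goals ring_nf

/-- closed form of `A j_1` [folklore] -/
def Aj1 (x : PhaseSpace 3) : ℝ :=
  (x.2 1 ^ 2 - x.2 2 ^ 2) / 2 * (1 + 3 * (x.1 2 - x.1 1) ^ 2) +
    ((x.1 2 - x.1 1) + (x.1 2 - x.1 1) ^ 3) / 2 *
      ((x.1 1 + x.1 1 ^ 3) + (x.1 2 + x.1 2 ^ 3) + ((x.1 1 - x.1 0) + (x.1 1 - x.1 0) ^ 3))

/-- `A_j1` (explicit computation / helper for the third-order witness). [folklore] -/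
theorem A_j1 (γ : ℝ) : liouvilleOp (P3 γ) 3 j1 = Aj1 := by
  funext x
  unfold liouvilleOp
  rw [Fin.sum_univ_three, partialQ0_j1, partialQ1_j1, partialQ2_j1, partialP0_j1, partialP1_j1, partialP2_j1,
    partialQ0_H, partialQ1_H, partialQ2_H]
  unfold Aj1
  ring

/-! level 2: partials of Aj1 and the closed form of A² j1 -/
theorem partialP0_Aj1 (x : PhaseSpace 3) : partialP 0 Aj1 x = 0 := by
  unfold partialP Aj1
  simp only [Function.update_self, upd01, upd02, upd10, upd12, upd20, upd21,
    Matrix.cons_val_zero, Matrix.cons_val_one, Matrix.head_cons, Matrix.cons_val_two, Matrix.tail_cons]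
  simp (disch := fun_prop) only [deriv_fun_add, deriv_fun_sub, deriv_fun_mul,
    deriv_fun_pow, deriv.fun_neg, deriv_const, deriv_id'', deriv_const_mul_field, deriv_mul_const_field, deriv_div_const,
    deriv_sub_const, deriv_const_sub, deriv_add_const, deriv_const_add, deriv_const_sub_self, deriv_const_sub_self',
    deriv_const_add_self, deriv_const_add_self', deriv_const_mul_self', deriv_const_mul_id, deriv_neg,
    Nat.cast_ofNat, one_mul, mul_one]
  all_goals ring_nf
/-- `partialP1_Aj1` (explicit computation / helper for the third-order witness). [folklore] -/
theorem partialP1_Aj1 (x : PhaseSpace 3) : partialP 1 Aj1 x = x.2 1 * (1 + 3 * (x.1 2 - x.1 1) ^ 2) := by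
  unfold partialP Aj1
  simp only [Function.update_self, upd01, upd02, upd10, upd12, upd20, upd21,
    Matrix.cons_val_zero, Matrix.cons_val_one, Matrix.head_cons, Matrix.cons_val_two, Matrix.tail_cons]
  simp (disch := fun_prop) only [deriv_fun_add, deriv_fun_sub, deriv_fun_mul,
    deriv_fun_pow, deriv.fun_neg, deriv_const, deriv_id'', deriv_const_mul_field, deriv_mul_const_field, deriv_div_const,
    deriv_sub_const, deriv_const_sub, deriv_add_const, deriv_const_add, deriv_const_sub_self, deriv_const_sub_self',
    deriv_const_add_self, deriv_const_add_self', deriv_const_mul_self', deriv_const_mul_id, deriv_neg,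
    Nat.cast_ofNat, one_mul, mul_one]
  all_goals ring_nf
/-- `partialP2_Aj1` (explicit computation / helper for the third-order witness). [folklore] -/
theorem partialP2_Aj1 (x : PhaseSpace 3) : partialP 2 Aj1 x = -(x.2 2 * (1 + 3 * (x.1 2 - x.1 1) ^ 2)) := by
  unfold partialP Aj1
  simp only [Function.update_self, upd01, upd02, upd10, upd12, upd20, upd21,
    Matrix.cons_val_zero, Matrix.cons_val_one, Matrix.head_cons, Matrix.cons_val_two, Matrix.tail_cons]
  simp (disch := fun_prop) only [deriv_fun_add, deriv_fun_sub, deriv_fun_mul,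
    deriv_fun_pow, deriv.fun_neg, deriv_const, deriv_id'', deriv_const_mul_field, deriv_mul_const_field, deriv_div_const,
    deriv_sub_const, deriv_const_sub, deriv_add_const, deriv_const_add, deriv_const_sub_self, deriv_const_sub_self',
    deriv_const_add_self, deriv_const_add_self', deriv_const_mul_self', deriv_const_mul_id, deriv_neg,
    Nat.cast_ofNat, one_mul, mul_one]
  all_goals ring_nf
/-- `partialQ0_Aj1` (explicit computation / helper for the third-order witness). [folklore] -/
theorem partialQ0_Aj1 (x : PhaseSpace 3) :
    partialQ 0 Aj1 x = -(((x.1 2 - x.1 1) + (x.1 2 - x.1 1) ^ 3) / 2 * (1 + 3 * (x.1 1 - x.1 0) ^ 2)) := by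
  unfold partialQ Aj1
  simp only [Function.update_self, upd01, upd02, upd10, upd12, upd20, upd21,
    Matrix.cons_val_zero, Matrix.cons_val_one, Matrix.head_cons, Matrix.cons_val_two, Matrix.tail_cons]
  simp (disch := fun_prop) only [deriv_fun_add, deriv_fun_sub, deriv_fun_mul,
    deriv_fun_pow, deriv.fun_neg, deriv_const, deriv_id'', deriv_const_mul_field, deriv_mul_const_field, deriv_div_const,
    deriv_sub_const, deriv_const_sub, deriv_add_const, deriv_const_add, deriv_const_sub_self, deriv_const_sub_self',
    deriv_const_add_self, deriv_const_add_self', deriv_const_mul_self', deriv_const_mul_id, deriv_neg,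
    Nat.cast_ofNat, one_mul, mul_one]
  all_goals ring_nf
/-- `T1 = ∂_{q_1}(A j_1)` [folklore] -/
def T1 (x : PhaseSpace 3) : ℝ :=
  -((x.2 1 ^ 2 - x.2 2 ^ 2) / 2 * (6 * (x.1 2 - x.1 1))) -
    (1 + 3 * (x.1 2 - x.1 1) ^ 2) / 2 *
      ((x.1 1 + x.1 1 ^ 3) + (x.1 2 + x.1 2 ^ 3) + ((x.1 1 - x.1 0) + (x.1 1 - x.1 0) ^ 3)) +
    ((x.1 2 - x.1 1) + (x.1 2 - x.1 1) ^ 3) / 2 * ((1 + 3 * x.1 1 ^ 2) + (1 + 3 * (x.1 1 - x.1 0) ^ 2))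
/-- `T2 = ∂_{q_2}(A j_1)` [folklore] -/
def T2 (x : PhaseSpace 3) : ℝ :=
  (x.2 1 ^ 2 - x.2 2 ^ 2) / 2 * (6 * (x.1 2 - x.1 1)) +
    (1 + 3 * (x.1 2 - x.1 1) ^ 2) / 2 *
      ((x.1 1 + x.1 1 ^ 3) + (x.1 2 + x.1 2 ^ 3) + ((x.1 1 - x.1 0) + (x.1 1 - x.1 0) ^ 3)) +
    ((x.1 2 - x.1 1) + (x.1 2 - x.1 1) ^ 3) / 2 * (1 + 3 * x.1 2 ^ 2)
/-- `partialQ1_Aj1` (explicit computation / helper for the third-order witness). [folklore] -/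
theorem partialQ1_Aj1 (x : PhaseSpace 3) : partialQ 1 Aj1 x = T1 x := by
  unfold partialQ Aj1 T1
  simp only [Function.update_self, upd01, upd02, upd10, upd12, upd20, upd21,
    Matrix.cons_val_zero, Matrix.cons_val_one, Matrix.head_cons, Matrix.cons_val_two, Matrix.tail_cons]
  simp (disch := fun_prop) only [deriv_fun_add, deriv_fun_sub, deriv_fun_mul,
    deriv_fun_pow, deriv.fun_neg, deriv_const, deriv_id'', deriv_const_mul_field, deriv_mul_const_field, deriv_div_const,
    deriv_sub_const, deriv_const_sub, deriv_add_const, deriv_const_add, deriv_const_sub_self, deriv_const_sub_self',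
    deriv_const_add_self, deriv_const_add_self', deriv_const_mul_self', deriv_const_mul_id, deriv_neg,
    Nat.cast_ofNat, one_mul, mul_one]
  all_goals ring_nf
/-- `partialQ2_Aj1` (explicit computation / helper for the third-order witness). [folklore] -/
theorem partialQ2_Aj1 (x : PhaseSpace 3) : partialQ 2 Aj1 x = T2 x := by
  unfold partialQ Aj1 T2
  simp only [Function.update_self, upd01, upd02, upd10, upd12, upd20, upd21,
    Matrix.cons_val_zero, Matrix.cons_val_one, Matrix.head_cons, Matrix.cons_val_two, Matrix.tail_cons]
  simp (disch := fun_prop) only [deriv_fun_add, deriv_fun_sub, deriv_fun_mul,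
    deriv_fun_pow, deriv.fun_neg, deriv_const, deriv_id'', deriv_const_mul_field, deriv_mul_const_field, deriv_div_const,
    deriv_sub_const, deriv_const_sub, deriv_add_const, deriv_const_add, deriv_const_sub_self, deriv_const_sub_self',
    deriv_const_add_self, deriv_const_add_self', deriv_const_mul_self', deriv_const_mul_id, deriv_neg,
    Nat.cast_ofNat, one_mul, mul_one]
  all_goals ring_nf

/-- closed form of `A² j_1` (as the Liouville combination of the level-2 partials) [folklore] -/
def A2j1 (x : PhaseSpace 3) : ℝ :=
  x.2 0 * (-(((x.1 2 - x.1 1) + (x.1 2 - x.1 1) ^ 3) / 2 * (1 + 3 * (x.1 1 - x.1 0) ^ 2))) +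
  x.2 1 * T1 x + x.2 2 * T2 x -
  ((x.1 1 + x.1 1 ^ 3) + ((x.1 1 - x.1 0) + (x.1 1 - x.1 0) ^ 3) - ((x.1 2 - x.1 1) + (x.1 2 - x.1 1) ^ 3)) *
    (x.2 1 * (1 + 3 * (x.1 2 - x.1 1) ^ 2)) -
  ((x.1 2 + x.1 2 ^ 3) + ((x.1 2 - x.1 1) + (x.1 2 - x.1 1) ^ 3)) * (-(x.2 2 * (1 + 3 * (x.1 2 - x.1 1) ^ 2)))

/-- `A_Aj1` (explicit computation / helper for the third-order witness). [folklore] -/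
theorem A_Aj1 (γ : ℝ) : liouvilleOp (P3 γ) 3 Aj1 = A2j1 := by
  funext x
  unfold liouvilleOp
  rw [Fin.sum_univ_three, partialQ0_Aj1, partialQ1_Aj1, partialQ2_Aj1, partialP0_Aj1, partialP1_Aj1, partialP2_Aj1,
    partialQ0_H, partialQ1_H, partialQ2_H]
  unfold A2j1
  ring

/-! level 3: numeric values at the three points -/
def qs : Fin 3 → ℝ := ![-1, 0, 1]
/-- `x0` (explicit computation / helper for the third-order witness). [folklore] -/
def x0 : PhaseSpace 3 := (qs, ![0, 0, 0])
/-- `x1` (explicit computation / helper for the third-order witness). [folklore] -/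
def x1 : PhaseSpace 3 := (qs, ![1, 0, 0])
/-- `x1'` (explicit computation / helper for the third-order witness). [folklore] -/
def x1' : PhaseSpace 3 := (qs, ![-1, 0, 0])

/-- `A2j1_x0` (explicit computation / helper for the third-order witness). [folklore] -/
theorem A2j1_x0 : A2j1 x0 = 0 := by simp [A2j1, T1, T2, x0, qs]
/-- `A2j1_x1` (explicit computation / helper for the third-order witness). [folklore] -/
theorem A2j1_x1 : A2j1 x1 = -4 := by simp [A2j1, T1, T2, x1, qs]; norm_num
/-- `A2j1_x1'` (explicit computation / helper for the third-order witness). [folklore] -/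
theorem A2j1_x1' : A2j1 x1' = 4 := by simp [A2j1, T1, T2, x1', qs]; norm_num

/-- `partialP0_A2j1_x0` (explicit computation / helper for the third-order witness). [folklore] -/
theorem partialP0_A2j1_x0 : partialP 0 A2j1 x0 = -4 := by
  unfold partialP A2j1 T1 T2 x0 qs
  simp only [Function.update_self, upd01, upd02, upd10, upd12, upd20, upd21,
    Matrix.cons_val_zero, Matrix.cons_val_one, Matrix.head_cons, Matrix.cons_val_two, Matrix.tail_cons]
  simp (disch := fun_prop) only [deriv_fun_add, deriv_fun_sub, deriv_fun_mul,
    deriv_fun_pow, deriv.fun_neg, deriv_const, deriv_id'', deriv_const_mul_field, deriv_mul_const_field, deriv_div_const,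
    deriv_sub_const, deriv_const_sub, deriv_add_const, deriv_const_add, deriv_const_sub_self, deriv_const_sub_self',
    deriv_const_add_self, deriv_const_add_self', deriv_const_mul_self', deriv_const_mul_id, deriv_neg,
    Nat.cast_ofNat, one_mul, mul_one]
  all_goals norm_num
/-- `partialP1_A2j1_x0` (explicit computation / helper for the third-order witness). [folklore] -/
theorem partialP1_A2j1_x0 : partialP 1 A2j1 x0 = -3 := by
  unfold partialP A2j1 T1 T2 x0 qs
  simp only [Function.update_self, upd01, upd02, upd10, upd12, upd20, upd21,
    Matrix.cons_val_zero, Matrix.cons_val_one, Matrix.head_cons, Matrix.cons_val_two, Matrix.tail_cons]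
  simp (disch := fun_prop) only [deriv_fun_add, deriv_fun_sub, deriv_fun_mul,
    deriv_fun_pow, deriv.fun_neg, deriv_const, deriv_id'', deriv_const_mul_field, deriv_mul_const_field, deriv_div_const,
    deriv_sub_const, deriv_const_sub, deriv_add_const, deriv_const_add, deriv_const_sub_self, deriv_const_sub_self',
    deriv_const_add_self, deriv_const_add_self', deriv_const_mul_self', deriv_const_mul_id, deriv_neg,
    Nat.cast_ofNat, one_mul, mul_one]
  all_goals norm_num
/-- `partialP2_A2j1_x0` (explicit computation / helper for the third-order witness). [folklore] -/
theorem partialP2_A2j1_x0 : partialP 2 A2j1 x0 = 28 := by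
  unfold partialP A2j1 T1 T2 x0 qs
  simp only [Function.update_self, upd01, upd02, upd10, upd12, upd20, upd21,
    Matrix.cons_val_zero, Matrix.cons_val_one, Matrix.head_cons, Matrix.cons_val_two, Matrix.tail_cons]
  simp (disch := fun_prop) only [deriv_fun_add, deriv_fun_sub, deriv_fun_mul,
    deriv_fun_pow, deriv.fun_neg, deriv_const, deriv_id'', deriv_const_mul_field, deriv_mul_const_field, deriv_div_const,
    deriv_sub_const, deriv_const_sub, deriv_add_const, deriv_const_add, deriv_const_sub_self, deriv_const_sub_self',
    deriv_const_add_self, deriv_const_add_self', deriv_const_mul_self', deriv_const_mul_id, deriv_neg,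
    Nat.cast_ofNat, one_mul, mul_one]
  all_goals norm_num
/-- `partialP0_A2j1_x1` (explicit computation / helper for the third-order witness). [folklore] -/
theorem partialP0_A2j1_x1 : partialP 0 A2j1 x1 = -4 := by
  unfold partialP A2j1 T1 T2 x1 qs
  simp only [Function.update_self, upd01, upd02, upd10, upd12, upd20, upd21,
    Matrix.cons_val_zero, Matrix.cons_val_one, Matrix.head_cons, Matrix.cons_val_two, Matrix.tail_cons]
  simp (disch := fun_prop) only [deriv_fun_add, deriv_fun_sub, deriv_fun_mul,
    deriv_fun_pow, deriv.fun_neg, deriv_const, deriv_id'', deriv_const_mul_field, deriv_mul_const_field, deriv_div_const,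
    deriv_sub_const, deriv_const_sub, deriv_add_const, deriv_const_add, deriv_const_sub_self, deriv_const_sub_self',
    deriv_const_add_self, deriv_const_add_self', deriv_const_mul_self', deriv_const_mul_id, deriv_neg,
    Nat.cast_ofNat, one_mul, mul_one]
  all_goals norm_num
/-- `partialP1_A2j1_x1` (explicit computation / helper for the third-order witness). [folklore] -/
theorem partialP1_A2j1_x1 : partialP 1 A2j1 x1 = -3 := by
  unfold partialP A2j1 T1 T2 x1 qs
  simp only [Function.update_self, upd01, upd02, upd10, upd12, upd20, upd21,
    Matrix.cons_val_zero, Matrix.cons_val_one, Matrix.head_cons, Matrix.cons_val_two, Matrix.tail_cons]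
  simp (disch := fun_prop) only [deriv_fun_add, deriv_fun_sub, deriv_fun_mul,
    deriv_fun_pow, deriv.fun_neg, deriv_const, deriv_id'', deriv_const_mul_field, deriv_mul_const_field, deriv_div_const,
    deriv_sub_const, deriv_const_sub, deriv_add_const, deriv_const_add, deriv_const_sub_self, deriv_const_sub_self',
    deriv_const_add_self, deriv_const_add_self', deriv_const_mul_self', deriv_const_mul_id, deriv_neg,
    Nat.cast_ofNat, one_mul, mul_one]
  all_goals norm_num
/-- `partialP2_A2j1_x1` (explicit computation / helper for the third-order witness). [folklore] -/
theorem partialP2_A2j1_x1 : partialP 2 A2j1 x1 = 28 := by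
  unfold partialP A2j1 T1 T2 x1 qs
  simp only [Function.update_self, upd01, upd02, upd10, upd12, upd20, upd21,
    Matrix.cons_val_zero, Matrix.cons_val_one, Matrix.head_cons, Matrix.cons_val_two, Matrix.tail_cons]
  simp (disch := fun_prop) only [deriv_fun_add, deriv_fun_sub, deriv_fun_mul,
    deriv_fun_pow, deriv.fun_neg, deriv_const, deriv_id'', deriv_const_mul_field, deriv_mul_const_field, deriv_div_const,
    deriv_sub_const, deriv_const_sub, deriv_add_const, deriv_const_add, deriv_const_sub_self, deriv_const_sub_self',
    deriv_const_add_self, deriv_const_add_self', deriv_const_mul_self', deriv_const_mul_id, deriv_neg,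
    Nat.cast_ofNat, one_mul, mul_one]
  all_goals norm_num
/-- `partialP0_A2j1_x1'` (explicit computation / helper for the third-order witness). [folklore] -/
theorem partialP0_A2j1_x1' : partialP 0 A2j1 x1' = -4 := by
  unfold partialP A2j1 T1 T2 x1' qs
  simp only [Function.update_self, upd01, upd02, upd10, upd12, upd20, upd21,
    Matrix.cons_val_zero, Matrix.cons_val_one, Matrix.head_cons, Matrix.cons_val_two, Matrix.tail_cons]
  simp (disch := fun_prop) only [deriv_fun_add, deriv_fun_sub, deriv_fun_mul,
    deriv_fun_pow, deriv.fun_neg, deriv_const, deriv_id'', deriv_const_mul_field, deriv_mul_const_field, deriv_div_const,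
    deriv_sub_const, deriv_const_sub, deriv_add_const, deriv_const_add, deriv_const_sub_self, deriv_const_sub_self',
    deriv_const_add_self, deriv_const_add_self', deriv_const_mul_self', deriv_const_mul_id, deriv_neg,
    Nat.cast_ofNat, one_mul, mul_one]
  all_goals norm_num
/-- `partialP1_A2j1_x1'` (explicit computation / helper for the third-order witness). [folklore] -/
theorem partialP1_A2j1_x1' : partialP 1 A2j1 x1' = -3 := by
  unfold partialP A2j1 T1 T2 x1' qs
  simp only [Function.update_self, upd01, upd02, upd10, upd12, upd20, upd21,
    Matrix.cons_val_zero, Matrix.cons_val_one, Matrix.head_cons, Matrix.cons_val_two, Matrix.tail_cons]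
  simp (disch := fun_prop) only [deriv_fun_add, deriv_fun_sub, deriv_fun_mul,
    deriv_fun_pow, deriv.fun_neg, deriv_const, deriv_id'', deriv_const_mul_field, deriv_mul_const_field, deriv_div_const,
    deriv_sub_const, deriv_const_sub, deriv_add_const, deriv_const_add, deriv_const_sub_self, deriv_const_sub_self',
    deriv_const_add_self, deriv_const_add_self', deriv_const_mul_self', deriv_const_mul_id, deriv_neg,
    Nat.cast_ofNat, one_mul, mul_one]
  all_goals norm_num
/-- `partialP2_A2j1_x1'` (explicit computation / helper for the third-order witness). [folklore] -/
theorem partialP2_A2j1_x1' : partialP 2 A2j1 x1' = 28 := by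
  unfold partialP A2j1 T1 T2 x1' qs
  simp only [Function.update_self, upd01, upd02, upd10, upd12, upd20, upd21,
    Matrix.cons_val_zero, Matrix.cons_val_one, Matrix.head_cons, Matrix.cons_val_two, Matrix.tail_cons]
  simp (disch := fun_prop) only [deriv_fun_add, deriv_fun_sub, deriv_fun_mul,
    deriv_fun_pow, deriv.fun_neg, deriv_const, deriv_id'', deriv_const_mul_field, deriv_mul_const_field, deriv_div_const,
    deriv_sub_const, deriv_const_sub, deriv_add_const, deriv_const_add, deriv_const_sub_self, deriv_const_sub_self',
    deriv_const_add_self, deriv_const_add_self', deriv_const_mul_self', deriv_const_mul_id, deriv_neg,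
    Nat.cast_ofNat, one_mul, mul_one]
  all_goals norm_num
/-- `partialQ0_A2j1_x1` (explicit computation / helper for the third-order witness). [folklore] -/
theorem partialQ0_A2j1_x1 : partialQ 0 A2j1 x1 = 6 := by
  unfold partialQ A2j1 T1 T2 x1 qs
  simp only [Function.update_self, upd01, upd02, upd10, upd12, upd20, upd21,
    Matrix.cons_val_zero, Matrix.cons_val_one, Matrix.head_cons, Matrix.cons_val_two, Matrix.tail_cons]
  simp (disch := fun_prop) only [deriv_fun_add, deriv_fun_sub, deriv_fun_mul,
    deriv_fun_pow, deriv.fun_neg, deriv_const, deriv_id'', deriv_const_mul_field, deriv_mul_const_field, deriv_div_const,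
    deriv_sub_const, deriv_const_sub, deriv_add_const, deriv_const_add, deriv_const_sub_self, deriv_const_sub_self',
    deriv_const_add_self, deriv_const_add_self', deriv_const_mul_self', deriv_const_mul_id, deriv_neg,
    Nat.cast_ofNat, one_mul, mul_one]
  all_goals norm_num
/-- `partialQ0_A2j1_x1'` (explicit computation / helper for the third-order witness). [folklore] -/
theorem partialQ0_A2j1_x1' : partialQ 0 A2j1 x1' = -6 := by
  unfold partialQ A2j1 T1 T2 x1' qs
  simp only [Function.update_self, upd01, upd02, upd10, upd12, upd20, upd21,
    Matrix.cons_val_zero, Matrix.cons_val_one, Matrix.head_cons, Matrix.cons_val_two, Matrix.tail_cons]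
  simp (disch := fun_prop) only [deriv_fun_add, deriv_fun_sub, deriv_fun_mul,
    deriv_fun_pow, deriv.fun_neg, deriv_const, deriv_id'', deriv_const_mul_field, deriv_mul_const_field, deriv_div_const,
    deriv_sub_const, deriv_const_sub, deriv_add_const, deriv_const_add, deriv_const_sub_self, deriv_const_sub_self',
    deriv_const_add_self, deriv_const_add_self', deriv_const_mul_self', deriv_const_mul_id, deriv_neg,
    Nat.cast_ofNat, one_mul, mul_one]
  all_goals norm_num


/-! ## Analysis I: a third-order sign lemma -/

open Set Filter Topology

/-- If `D₀' = D₁`, `D₁' = D₂`, `D₂' = D₃` on `(0, δ)`, all continuous on `[0, δ]` (resp. `D₃` right-continuous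
at `0`), `D₀(0) = D₁(0) = D₂(0) = 0` and `D₃(0) > 0`, then `D₀ > 0` on some `(0, s₀]`. [folklore] -/
theorem exists_pos_of_deriv3_pos {D0 D1 D2 D3 : ℝ → ℝ} {δ : ℝ} (hδ : 0 < δ)
    (hc0 : ContinuousOn D0 (Icc 0 δ)) (hc1 : ContinuousOn D1 (Icc 0 δ)) (hc2 : ContinuousOn D2 (Icc 0 δ))
    (hc3 : ContinuousWithinAt D3 (Ici 0) 0)
    (hd0 : ∀ s ∈ Ioo 0 δ, HasDerivAt D0 (D1 s) s) (hd1 : ∀ s ∈ Ioo 0 δ, HasDerivAt D1 (D2 s) s)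
    (hd2 : ∀ s ∈ Ioo 0 δ, HasDerivAt D2 (D3 s) s)
    (h0 : D0 0 = 0) (h1 : D1 0 = 0) (h2 : D2 0 = 0) (h3 : 0 < D3 0) :
    ∃ s₀, 0 < s₀ ∧ ∀ s ∈ Ioc 0 s₀, 0 < D0 s := by
  -- `D3 > 0` on a right neighbourhood of `0`
  have hev : ∀ᶠ s in 𝓝[Ici 0] 0, 0 < D3 s := hc3.eventually (lt_mem_nhds h3)
  rw [Filter.Eventually, mem_nhdsGE_iff_exists_Ico_subset] at hev
  obtain ⟨u, hu, hsub⟩ := hev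
  have hu0 : 0 < u := hu
  set s₀ : ℝ := min (u / 2) (δ / 2) with hs₀
  have hs₀pos : 0 < s₀ := lt_min (by linarith) (by linarith)
  have hs₀u : s₀ < u := (min_le_left _ _).trans_lt (by linarith)
  have hs₀δ : s₀ < δ := (min_le_right _ _).trans_lt (by linarith)
  have hpos3 : ∀ s ∈ Icc 0 s₀, 0 < D3 s := fun s hs => hsub ⟨hs.1, hs.2.trans_lt hs₀u⟩
  have hIcc : Icc 0 s₀ ⊆ Icc 0 δ := Icc_subset_Icc le_rfl hs₀δ.le
  have hIoo : ∀ s ∈ Ioo 0 s₀, s ∈ Ioo 0 δ := fun s hs => ⟨hs.1, hs.2.trans hs₀δ⟩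
  -- `D2` strictly increasing, hence positive
  have hm2 : StrictMonoOn D2 (Icc 0 s₀) := by
    refine strictMonoOn_of_deriv_pos (convex_Icc 0 s₀) (hc2.mono hIcc) fun s hs => ?_
    rw [interior_Icc] at hs
    rw [(hd2 s (hIoo s hs)).deriv]
    exact hpos3 s (Ioo_subset_Icc_self hs)
  have hpos2 : ∀ s ∈ Ioc 0 s₀, 0 < D2 s := fun s hs => by
    have := hm2 ⟨le_rfl, hs₀pos.le⟩ ⟨hs.1.le, hs.2⟩ hs.1
    rwa [h2] at this
  have hm1 : StrictMonoOn D1 (Icc 0 s₀) := by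
    refine strictMonoOn_of_deriv_pos (convex_Icc 0 s₀) (hc1.mono hIcc) fun s hs => ?_
    rw [interior_Icc] at hs
    rw [(hd1 s (hIoo s hs)).deriv]
    exact hpos2 s ⟨hs.1, hs.2.le⟩
  have hpos1 : ∀ s ∈ Ioc 0 s₀, 0 < D1 s := fun s hs => by
    have := hm1 ⟨le_rfl, hs₀pos.le⟩ ⟨hs.1.le, hs.2⟩ hs.1
    rwa [h1] at this
  have hm0 : StrictMonoOn D0 (Icc 0 s₀) := by
    refine strictMonoOn_of_deriv_pos (convex_Icc 0 s₀) (hc0.mono hIcc) fun s hs => ?_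
    rw [interior_Icc] at hs
    rw [(hd0 s (hIoo s hs)).deriv]
    exact hpos1 s ⟨hs.1, hs.2.le⟩
  refine ⟨s₀, hs₀pos, fun s hs => ?_⟩
  have := hm0 ⟨le_rfl, hs₀pos.le⟩ ⟨hs.1.le, hs.2⟩ hs.1
  rwa [h0] at this

/-- Signed version: `D₃(0) ≠ 0` ⇒ `D₀ ≠ 0` on some `(0, s₀]`. [folklore] -/
theorem exists_ne_zero_of_deriv3_ne_zero {D0 D1 D2 D3 : ℝ → ℝ} {δ : ℝ} (hδ : 0 < δ)
    (hc0 : ContinuousOn D0 (Icc 0 δ)) (hc1 : ContinuousOn D1 (Icc 0 δ)) (hc2 : ContinuousOn D2 (Icc 0 δ))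
    (hc3 : ContinuousWithinAt D3 (Ici 0) 0)
    (hd0 : ∀ s ∈ Ioo 0 δ, HasDerivAt D0 (D1 s) s) (hd1 : ∀ s ∈ Ioo 0 δ, HasDerivAt D1 (D2 s) s)
    (hd2 : ∀ s ∈ Ioo 0 δ, HasDerivAt D2 (D3 s) s)
    (h0 : D0 0 = 0) (h1 : D1 0 = 0) (h2 : D2 0 = 0) (h3 : D3 0 ≠ 0) :
    ∃ s₀, 0 < s₀ ∧ ∀ s ∈ Ioc 0 s₀, D0 s ≠ 0 := by
  rcases lt_or_gt_of_ne h3 with hneg | hpos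
  · obtain ⟨s₀, hs₀, H⟩ := exists_pos_of_deriv3_pos (D0 := fun s => -D0 s) (D1 := fun s => -D1 s)
      (D2 := fun s => -D2 s) (D3 := fun s => -D3 s) hδ hc0.neg hc1.neg hc2.neg hc3.neg
      (fun s hs => (hd0 s hs).neg) (fun s hs => (hd1 s hs).neg) (fun s hs => (hd2 s hs).neg)
      (by simp [h0]) (by simp [h1]) (by simp [h2]) (by simpa using hneg)
    exact ⟨s₀, hs₀, fun s hs => by have := H s hs; linarith⟩
  · obtain ⟨s₀, hs₀, H⟩ := exists_pos_of_deriv3_pos hδ hc0 hc1 hc2 hc3 hd0 hd1 hd2 h0 h1 h2 hpos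
    exact ⟨s₀, hs₀, fun s hs => (H s hs).ne'⟩

/-! ## Analysis II: time derivatives of observables along the closed flow (two-sided, `s > 0`) -/

section FlowDeriv
open Summit.AtomisticToContinuum.FouriersLaw.Theorems.ClosedConeSensitivity.Negative.ZeroFrictionDictionary
open Summit.AtomisticToContinuum.FouriersLaw.Theorems.OddSectorIrreversibility.Corrector

variable {ω₂ lam β : ℝ} (hω : 0 < ω₂) (hl : 0 ≤ lam) (hβ : 0 ≤ β)
include hω hl hβ

/-- `s ↦ f(Φ_s x)` has derivative `(X_H f)(Φ_s x)` at every `s > 0` (two-sided). [folklore] -/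
theorem hasDerivAt_comp_detFlow (γ : ℝ) (N : ℕ) {f : PhaseSpace N → ℝ} (hf : ContDiff ℝ 1 f)
    (x : PhaseSpace N) {s : ℝ} (hs : 0 < s) :
    HasDerivAt (fun r => f (detFlow ω₂ lam β N r x))
      (liouvilleOp (pinnedChain ω₂ lam β γ) N f (detFlow ω₂ lam β N s x)) s := by
  set P := pinnedChain ω₂ lam β γ with hP
  have hU : Differentiable ℝ P.U := (pinnedChain_contDiff_U ω₂ lam β γ (n := 1)).differentiable one_ne_zero
  have hV : Differentiable ℝ P.V := (pinnedChain_contDiff_V ω₂ lam β γ (n := 1)).differentiable one_ne_zero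
  have hfd : Differentiable ℝ f := hf.differentiable one_ne_zero
  have h := (hfd (detFlow ω₂ lam β N s x)).hasFDerivAt.comp_hasDerivAt s (hasDerivAt_detFlow hω hl hβ N x hs)
  rw [liouvilleOp_eq_fderiv P hU hV hfd, hamField_indep_friction (ω₂ := ω₂) (lam := lam) (β := β)]
  exact h

/-- `s ↦ f(Φ_s x)` is continuous. [folklore] -/
theorem continuous_comp_detFlow (N : ℕ) {f : PhaseSpace N → ℝ} (hf : Continuous f) (x : PhaseSpace N) :
    Continuous fun r => f (detFlow ω₂ lam β N r x) :=
  hf.comp (Summit.AtomisticToContinuum.FouriersLaw.Theorems.OddSectorIrreversibility.Corrector.continuous_detFlow_time hω hl hβ N x)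

end FlowDeriv

/-! ## Analysis III: the `N = 3` witness — `p_0`-dependence of the time-symmetrised current at order `s³` -/

section N3
open Summit.AtomisticToContinuum.FouriersLaw.Theorems.ClosedConeSensitivity.Negative.ZeroFrictionDictionary
open Summit.AtomisticToContinuum.FouriersLaw.Theorems.OddSectorIrreversibility.Corrector

/-- the closed flow of the 3-chain `(ω₂, lam, β) = (1,1,1)` [folklore] -/
abbrev Φ3 (s : ℝ) (x : PhaseSpace 3) : PhaseSpace 3 := detFlow 1 1 1 3 s x

/-- `Ψ_F(s) = (F(Φ_s x₁) + F(Φ_s x₁'))/2 − F(Φ_s x₀)`. [folklore] -/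
def Psi (F : PhaseSpace 3 → ℝ) (s : ℝ) : ℝ := (F (Φ3 s x1) + F (Φ3 s x1')) / 2 - F (Φ3 s x0)

/-- `Psi_zero` (explicit computation / helper for the third-order witness). [folklore] -/
theorem Psi_zero (F : PhaseSpace 3 → ℝ) : Psi F 0 = (F x1 + F x1') / 2 - F x0 := by
  simp [Psi, detFlow_of_nonpos]

/-- `hasDerivAt_Psi` (explicit computation / helper for the third-order witness). [folklore] -/
theorem hasDerivAt_Psi (γ : ℝ) {F : PhaseSpace 3 → ℝ} (hF : ContDiff ℝ 1 F) {s : ℝ} (hs : 0 < s) :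
    HasDerivAt (Psi F) (Psi (liouvilleOp (P3 γ) 3 F) s) s := by
  have h1 := hasDerivAt_comp_detFlow one_pos zero_le_one zero_le_one γ 3 hF x1 hs
  have h1' := hasDerivAt_comp_detFlow one_pos zero_le_one zero_le_one γ 3 hF x1' hs
  have h0 := hasDerivAt_comp_detFlow one_pos zero_le_one zero_le_one γ 3 hF x0 hs
  exact ((h1.add h1').div_const 2).sub h0

/-- `continuous_Psi` (explicit computation / helper for the third-order witness). [folklore] -/
theorem continuous_Psi {F : PhaseSpace 3 → ℝ} (hF : Continuous F) : Continuous (Psi F) := by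
  unfold Psi
  have h1 := continuous_comp_detFlow one_pos zero_le_one zero_le_one 3 hF x1
  have h1' := continuous_comp_detFlow one_pos zero_le_one zero_le_one 3 hF x1'
  have h0 := continuous_comp_detFlow one_pos zero_le_one zero_le_one 3 hF x0
  exact ((h1.add h1').div_const 2).sub h0

/-! smoothness of the explicit observables -/
theorem contDiff_coordQ (i : Fin 3) : ContDiff ℝ ∞ fun x : PhaseSpace 3 => x.1 i :=
  (contDiff_apply ℝ ℝ i).comp contDiff_fst
/-- `contDiff_coordP` (explicit computation / helper for the third-order witness). [folklore] -/
theorem contDiff_coordP (i : Fin 3) : ContDiff ℝ ∞ fun x : PhaseSpace 3 => x.2 i :=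
  (contDiff_apply ℝ ℝ i).comp contDiff_snd

attribute [local fun_prop] contDiff_coordQ contDiff_coordP

/-- `contDiff_j1` (explicit computation / helper for the third-order witness). [folklore] -/
theorem contDiff_j1 : ContDiff ℝ ∞ j1 := by unfold j1; fun_prop
/-- `contDiff_Aj1` (explicit computation / helper for the third-order witness). [folklore] -/
theorem contDiff_Aj1 : ContDiff ℝ ∞ Aj1 := by unfold Aj1; fun_prop
/-- `contDiff_T1` (explicit computation / helper for the third-order witness). [folklore] -/
theorem contDiff_T1 : ContDiff ℝ ∞ T1 := by unfold T1; fun_prop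
/-- `contDiff_T2` (explicit computation / helper for the third-order witness). [folklore] -/
theorem contDiff_T2 : ContDiff ℝ ∞ T2 := by unfold T2; fun_prop
/-- `contDiff_A2j1` (explicit computation / helper for the third-order witness). [folklore] -/
theorem contDiff_A2j1 : ContDiff ℝ ∞ A2j1 := by
  have := contDiff_T1; have := contDiff_T2
  unfold A2j1; fun_prop

/-- `X_H F` is continuous for `F ∈ C¹`. [folklore] -/
theorem continuous_liouvilleOp3 (γ : ℝ) {F : PhaseSpace 3 → ℝ} (hF : ContDiff ℝ 1 F) :
    Continuous (liouvilleOp (P3 γ) 3 F) := by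
  have hH1 : ContDiff ℝ 1 ((P3 γ).hamiltonian 3) := pinnedChain_contDiff_hamiltonian 1 1 1 γ 3
  have hQc := fun i => continuous_partialQ hF one_ne_zero i
  have hPc := fun i => continuous_partialP hF one_ne_zero i
  have hWc := fun i => continuous_partialQ hH1 one_ne_zero i
  unfold liouvilleOp
  fun_prop

/-! the values at `s = 0` -/
theorem neg_p_x1 : (-(![1, 0, 0] : Fin 3 → ℝ)) = ![-1, 0, 0] := by
  ext i; fin_cases i <;> simp

/-- `Psi_j1_zero` (explicit computation / helper for the third-order witness). [folklore] -/
theorem Psi_j1_zero : Psi j1 0 = 0 := by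
  rw [Psi_zero]; simp [j1, x1, x1', x0, qs]
/-- `Psi_Aj1_zero` (explicit computation / helper for the third-order witness). [folklore] -/
theorem Psi_Aj1_zero : Psi Aj1 0 = 0 := by
  rw [Psi_zero]; simp [Aj1, x1, x1', x0, qs]
/-- `Psi_A2j1_zero` (explicit computation / helper for the third-order witness). [folklore] -/
theorem Psi_A2j1_zero : Psi A2j1 0 = 0 := by
  rw [Psi_zero, A2j1_x0, A2j1_x1, A2j1_x1']
  norm_num

/-- `partialQ0_H_qs` (explicit computation / helper for the third-order witness). [folklore] -/
theorem partialQ0_H_qs (γ : ℝ) (p : Fin 3 → ℝ) : partialQ 0 ((P3 γ).hamiltonian 3) (qs, p) = -4 := by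
  rw [partialQ0_H]
  simp [qs]
  norm_num
/-- `partialQ1_H_qs` (explicit computation / helper for the third-order witness). [folklore] -/
theorem partialQ1_H_qs (γ : ℝ) (p : Fin 3 → ℝ) : partialQ 1 ((P3 γ).hamiltonian 3) (qs, p) = 0 := by
  rw [partialQ1_H]
  simp [qs]
/-- `partialQ2_H_qs` (explicit computation / helper for the third-order witness). [folklore] -/
theorem partialQ2_H_qs (γ : ℝ) (p : Fin 3 → ℝ) : partialQ 2 ((P3 γ).hamiltonian 3) (qs, p) = 4 := by
  rw [partialQ2_H]
  simp [qs]
  norm_num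

/-- `A3j1_x0` (explicit computation / helper for the third-order witness). [folklore] -/
theorem A3j1_x0 (γ : ℝ) : liouvilleOp (P3 γ) 3 A2j1 x0 = -128 := by
  unfold liouvilleOp
  rw [Fin.sum_univ_three, partialP0_A2j1_x0, partialP1_A2j1_x0, partialP2_A2j1_x0]
  rw [show x0 = (qs, ![0, 0, 0]) from rfl, partialQ0_H_qs, partialQ1_H_qs, partialQ2_H_qs]
  simp
  norm_num
/-- `A3j1_x1` (explicit computation / helper for the third-order witness). [folklore] -/
theorem A3j1_x1 (γ : ℝ) : liouvilleOp (P3 γ) 3 A2j1 x1 = -122 := by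
  unfold liouvilleOp
  rw [Fin.sum_univ_three, partialP0_A2j1_x1, partialP1_A2j1_x1, partialP2_A2j1_x1, partialQ0_A2j1_x1]
  rw [show x1 = (qs, ![1, 0, 0]) from rfl, partialQ0_H_qs, partialQ1_H_qs, partialQ2_H_qs]
  simp
  norm_num
/-- `A3j1_x1'` (explicit computation / helper for the third-order witness). [folklore] -/
theorem A3j1_x1' (γ : ℝ) : liouvilleOp (P3 γ) 3 A2j1 x1' = -122 := by
  unfold liouvilleOp
  rw [Fin.sum_univ_three, partialP0_A2j1_x1', partialP1_A2j1_x1', partialP2_A2j1_x1', partialQ0_A2j1_x1']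
  rw [show x1' = (qs, ![-1, 0, 0]) from rfl, partialQ0_H_qs, partialQ1_H_qs, partialQ2_H_qs]
  simp
  norm_num

/-- `Psi_A3j1_zero` (explicit computation / helper for the third-order witness). [folklore] -/
theorem Psi_A3j1_zero (γ : ℝ) : Psi (liouvilleOp (P3 γ) 3 A2j1) 0 = 6 := by
  rw [Psi_zero, A3j1_x0, A3j1_x1, A3j1_x1']
  norm_num

/-- **The third-order fact.** For the anharmonic 3-chain there is `s₀ > 0` such that for every
`s ∈ (0, s₀]` the time-symmetrised transported current distinguishes the two initial momenta at the
contact: `(j_1(Φ_s x₁) + j_1(Φ_s Θx₁))/2 ≠ j_1(Φ_s x₀)` with `x₁ − x₀ = e_{p_0}`, `Θx₀ = x₀`. [folklore] -/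
theorem exists_window_Psi_j1_ne_zero (γ : ℝ) : ∃ s₀, 0 < s₀ ∧ ∀ s ∈ Ioc 0 s₀, Psi j1 s ≠ 0 := by
  have hj : ContDiff ℝ 1 j1 := contDiff_j1.of_le (by exact_mod_cast le_top)
  have hA : ContDiff ℝ 1 Aj1 := contDiff_Aj1.of_le (by exact_mod_cast le_top)
  have hA2 : ContDiff ℝ 1 A2j1 := contDiff_A2j1.of_le (by exact_mod_cast le_top)
  refine exists_ne_zero_of_deriv3_ne_zero (δ := 1) one_pos (D0 := Psi j1) (D1 := Psi Aj1) (D2 := Psi A2j1)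
    (D3 := Psi (liouvilleOp (P3 γ) 3 A2j1))
    (continuous_Psi hj.continuous).continuousOn (continuous_Psi hA.continuous).continuousOn
    (continuous_Psi hA2.continuous).continuousOn
    (continuous_Psi (continuous_liouvilleOp3 γ hA2)).continuousWithinAt
    (fun s hs => ?_) (fun s hs => ?_) (fun s hs => ?_)
    Psi_j1_zero Psi_Aj1_zero Psi_A2j1_zero (by rw [Psi_A3j1_zero]; norm_num)
  · have h := hasDerivAt_Psi γ hj hs.1
    rwa [A_j1] at h
  · have h := hasDerivAt_Psi γ hA hs.1
    rwa [A_Aj1] at h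
  · exact hasDerivAt_Psi γ hA2 hs.1

end N3

/-! ## Analysis IV: from the third-order fact to a strictly positive tap-leak pairing -/

section Pairing
open MeasureTheory
open Summit.AtomisticToContinuum.FouriersLaw.Theorems.ClosedConeSensitivity.Negative.ZeroFrictionDictionary
open Summit.AtomisticToContinuum.FouriersLaw.Theorems.OddSectorIrreversibility.Corrector
open Summit.AtomisticToContinuum.FouriersLaw.Theorems.OddSectorWitness

/-- the transported middle current `j_1 ∘ Φ_s` of the 3-chain [folklore] -/
def cf (s : ℝ) (y : PhaseSpace 3) : ℝ := j1 (Φ3 s y)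
/-- its time-symmetrisation `w_s = (j_1∘Φ_s + j_1∘Φ_s∘Θ)/2` (Θ-even) [folklore] -/
def w (s : ℝ) (y : PhaseSpace 3) : ℝ := (cf s y + cf s (y.1, -y.2)) / 2

/-- `cf_eq` (explicit computation / helper for the third-order witness). [folklore] -/
theorem cf_eq (γ : ℝ) {s : ℝ} :
    cf s = fun y : PhaseSpace 3 => (pinnedChain 1 1 1 γ).bondCurrent 3 1 (detFlow 1 1 1 3 s y) := by
  funext y; rw [bondCurrent_one_eq]; rfl

/-- `contDiff_cf` (explicit computation / helper for the third-order witness). [folklore] -/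
theorem contDiff_cf {s : ℝ} (hs : 0 ≤ s) : ContDiff ℝ ∞ (cf s) := by
  rw [cf_eq 0]; exact contDiff_currentFlow one_pos one_pos zero_le_one 0 3 1 hs

/-- `contDiff_flip3` (explicit computation / helper for the third-order witness). [folklore] -/
theorem contDiff_flip3 : ContDiff ℝ ∞ fun y : PhaseSpace 3 => ((y.1, -y.2) : PhaseSpace 3) :=
  contDiff_fst.prodMk contDiff_snd.neg

/-- `contDiff_w` (explicit computation / helper for the third-order witness). [folklore] -/
theorem contDiff_w {s : ℝ} (hs : 0 ≤ s) : ContDiff ℝ ∞ (w s) := by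
  unfold w
  exact (((contDiff_cf hs).add ((contDiff_cf hs).comp contDiff_flip3)).div_const 2)

/-- `w_flip` (explicit computation / helper for the third-order witness). [folklore] -/
theorem w_flip (s : ℝ) (y : PhaseSpace 3) : w s (y.1, -y.2) = w s y := by
  simp only [w, neg_neg, Prod.mk.eta]; ring

/-- `neg_p_x0` (explicit computation / helper for the third-order witness). [folklore] -/
theorem neg_p_x0 : (-(![0, 0, 0] : Fin 3 → ℝ)) = ![0, 0, 0] := by
  ext i; fin_cases i <;> simp

/-- `w_x1_sub_w_x0` (explicit computation / helper for the third-order witness). [folklore] -/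
theorem w_x1_sub_w_x0 (s : ℝ) : w s x1 - w s x0 = Psi j1 s := by
  simp only [w, cf, Psi, x1, x1', x0, neg_p_x1, neg_p_x0]
  ring

/-- `single0_eq` (explicit computation / helper for the third-order witness). [folklore] -/
theorem single0_eq (t : ℝ) : (Pi.single (0 : Fin 3) t : Fin 3 → ℝ) = ![t, 0, 0] := by
  ext i; fin_cases i <;> simp

/-- the `p_0`-line through `x₀`: `x₀ + t e_{p_0}` [folklore] -/
theorem x0_add_smul (t : ℝ) : x0 + t • ((0, Pi.single 0 1) : PhaseSpace 3) = (qs, ![t, 0, 0]) := by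
  rw [← single0_eq]
  refine Prod.ext ?_ ?_
  · simp [x0]
  · ext i
    fin_cases i <;> simp [x0, Matrix.vecHead, Matrix.vecTail]

/-- **Some `p_0`-derivative of `w_s` is non-zero** once `Ψ_{j_1}(s) ≠ 0` (mean value theorem on the
segment from `x₀` to `x₁ = x₀ + e_{p_0}`). [folklore] -/
theorem exists_partialP_w_ne_zero {s : ℝ} (hs : 0 ≤ s) (hΨ : Psi j1 s ≠ 0) :
    ∃ z : PhaseSpace 3, partialP 0 (w s) z ≠ 0 := by
  set e : PhaseSpace 3 := (0, Pi.single 0 1) with he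
  set g : ℝ → ℝ := fun t => w s (x0 + t • e) with hg
  have hwd : Differentiable ℝ (w s) := (contDiff_w hs).differentiable (by simp)
  have hderiv : ∀ t, HasDerivAt g (partialP 0 (w s) (x0 + t • e)) t := by
    intro t
    have hline : HasDerivAt (fun r : ℝ => x0 + r • e) e t := by
      simpa using ((hasDerivAt_id t).smul_const e).const_add x0
    have h := ((hwd (x0 + t • e)).hasFDerivAt).comp_hasDerivAt t hline
    rw [partialP_eq_fderiv hwd]
    exact h
  have hcont : Continuous g := by
    rw [hg]; exact hwd.continuous.comp (continuous_const.add (continuous_id.smul continuous_const))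
  obtain ⟨c, _, hslope⟩ := exists_hasDerivAt_eq_slope g (fun t => partialP 0 (w s) (x0 + t • e)) one_pos
    hcont.continuousOn (fun t _ => hderiv t)
  refine ⟨x0 + c • e, ?_⟩
  rw [hslope]
  have hg1 : g 1 = w s x1 := by simp only [hg, he, x0_add_smul]; rfl
  have hg0 : g 0 = w s x0 := by simp only [hg, he, x0_add_smul]; rfl
  rw [hg1, hg0, sub_zero, div_one, w_x1_sub_w_x0]
  exact hΨ

end Pairing

/-! ## Analysis V: the positive pairing and the refutation of the corrector-free variant of `P` -/

section Refute
open MeasureTheory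
open Summit.AtomisticToContinuum.FouriersLaw.Theorems.ClosedConeSensitivity.Negative.ZeroFrictionDictionary
open Summit.AtomisticToContinuum.FouriersLaw.Theorems.OddSectorIrreversibility.Corrector
open Summit.AtomisticToContinuum.FouriersLaw.Theorems.OddSectorWitness

/-- the Gibbs weight `e^{-H/T} dq dp` of the 3-chain (`ω₂ = lam = β = 1`) [folklore] -/
abbrev μ3 (γ T : ℝ) : Measure (PhaseSpace 3) := gibbsWeight 1 1 1 γ 3 T

/-- `partialP_w_eq` (explicit computation / helper for the third-order witness). [folklore] -/
theorem partialP_w_eq {s : ℝ} (hs : 0 ≤ s) (y : PhaseSpace 3) :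
    partialP 0 (w s) y = (partialP 0 (cf s) y - partialP 0 (cf s) (y.1, -y.2)) / 2 :=
  partialP_evenPart 3 ((contDiff_cf hs).of_le (by exact_mod_cast le_top)) 0 y

/-- `partialP_w_flip` (explicit computation / helper for the third-order witness). [folklore] -/
theorem partialP_w_flip (s : ℝ) (y : PhaseSpace 3) : partialP 0 (w s) (y.1, -y.2) = -partialP 0 (w s) y := by
  have h := partialP_comp_momentumReversal 3 (w s) 0 y
  have hfun : (fun z : PhaseSpace 3 => w s (z.1, -z.2)) = w s := funext fun z => w_flip s z
  rw [hfun] at h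
  linarith

/-- `integrable_sq_partialP_cf` (explicit computation / helper for the third-order witness). [folklore] -/
theorem integrable_sq_partialP_cf (γ : ℝ) {s : ℝ} (hs : 0 ≤ s) {T : ℝ} (hT : 0 < T) :
    Integrable (fun y => (partialP 0 (cf s) y) ^ 2) (μ3 γ T) := by
  have h := integrable_sq_partialP_currentFlow one_pos one_pos zero_le_one γ 3 1 0 hs hT
  rw [← cf_eq γ] at h
  rw [integrable_gibbsWeight_iff]
  refine h.congr (ae_of_all _ fun x => ?_)
  simp only [OscillatorChain.gibbsDensity]
  rw [mul_comm, neg_div]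

/-- `integrable_sq_partialP_cf_flip` (explicit computation / helper for the third-order witness). [folklore] -/
theorem integrable_sq_partialP_cf_flip (γ : ℝ) {s : ℝ} (hs : 0 ≤ s) {T : ℝ} (hT : 0 < T) :
    Integrable (fun y : PhaseSpace 3 => (partialP 0 (cf s) (y.1, -y.2)) ^ 2) (μ3 γ T) := by
  have h := integrable_sq_partialP_cf γ hs hT
  have hmp := measurePreserving_momentumReversal_gibbsWeight (ω₂ := 1) (lam := 1) (β := 1) γ 3 T
  exact (hmp.integrable_comp h.aestronglyMeasurable).mpr h

/-- `continuous_partialP_cf` (explicit computation / helper for the third-order witness). [folklore] -/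
theorem continuous_partialP_cf {s : ℝ} (hs : 0 ≤ s) : Continuous (partialP 0 (cf s)) :=
  continuous_partialP ((contDiff_cf hs).of_le (by exact_mod_cast le_top) : ContDiff ℝ 1 (cf s)) one_ne_zero 0

/-- `continuous_partialP_w` (explicit computation / helper for the third-order witness). [folklore] -/
theorem continuous_partialP_w {s : ℝ} (hs : 0 ≤ s) : Continuous (partialP 0 (w s)) :=
  continuous_partialP ((contDiff_w hs).of_le (by exact_mod_cast le_top) : ContDiff ℝ 1 (w s)) one_ne_zero 0

/-- `integrable_sq_partialP_w` (explicit computation / helper for the third-order witness). [folklore] -/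
theorem integrable_sq_partialP_w (γ : ℝ) {s : ℝ} (hs : 0 ≤ s) {T : ℝ} (hT : 0 < T) :
    Integrable (fun y => (partialP 0 (w s) y) ^ 2) (μ3 γ T) := by
  have ha := integrable_sq_partialP_cf γ hs hT
  have hb := integrable_sq_partialP_cf_flip γ hs hT
  refine ((ha.add hb).div_const 2).mono' ((continuous_partialP_w hs).pow 2).aestronglyMeasurable
    (ae_of_all _ fun y => ?_)
  rw [Real.norm_eq_abs, abs_of_nonneg (sq_nonneg _), partialP_w_eq hs]
  simp only [Pi.add_apply]
  nlinarith [sq_nonneg (partialP 0 (cf s) y + partialP 0 (cf s) (y.1, -y.2))]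

/-- products of the tap derivative of `w_s` with `L²` factors are integrable [folklore] -/
theorem integrable_partialP_w_mul (γ : ℝ) {s : ℝ} (hs : 0 ≤ s) {T : ℝ} (hT : 0 < T) {g : PhaseSpace 3 → ℝ}
    (hgc : Continuous g) (hg : Integrable (fun y => (g y) ^ 2) (μ3 γ T)) :
    Integrable (fun y => partialP 0 (w s) y * g y) (μ3 γ T) := by
  have hw := integrable_sq_partialP_w γ hs hT
  refine ((hw.add hg).div_const 2).mono' (((continuous_partialP_w hs).mul hgc).aestronglyMeasurable)
    (ae_of_all _ fun y => ?_)
  rw [Real.norm_eq_abs]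
  simp only [Pi.add_apply]
  rw [abs_mul, ← sq_abs (partialP 0 (w s) y), ← sq_abs (g y)]
  nlinarith [sq_nonneg (|partialP 0 (w s) y| - |g y|), abs_nonneg (partialP 0 (w s) y), abs_nonneg (g y)]

/-- **The tap-leak pairing of `w_s` against `j_1∘Φ_s` is the squared `L²`-norm of `∂_{p_0} w_s`.** [folklore] -/
theorem pairing_w_cf_eq (γ : ℝ) {s : ℝ} (hs : 0 ≤ s) {T : ℝ} (hT : 0 < T) :
    ∫ y, partialP 0 (w s) y * partialP 0 (cf s) y ∂(μ3 γ T) = ∫ y, (partialP 0 (w s) y) ^ 2 ∂(μ3 γ T) := by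
  set a : PhaseSpace 3 → ℝ := partialP 0 (cf s) with ha
  set b : PhaseSpace 3 → ℝ := fun y => partialP 0 (cf s) (y.1, -y.2) with hb
  set dw : PhaseSpace 3 → ℝ := partialP 0 (w s) with hdw
  have hIa : Integrable (fun y => dw y * a y) (μ3 γ T) :=
    integrable_partialP_w_mul γ hs hT (continuous_partialP_cf hs) (integrable_sq_partialP_cf γ hs hT)
  have hIb : Integrable (fun y => dw y * b y) (μ3 γ T) :=
    integrable_partialP_w_mul γ hs hT ((continuous_partialP_cf hs).comp (by fun_prop))
      (integrable_sq_partialP_cf_flip γ hs hT)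
  -- change of variables under `Θ`
  have hflip : ∫ y, dw y * a y ∂(μ3 γ T) = -∫ y, dw y * b y ∂(μ3 γ T) := by
    rw [← integral_comp_momentumReversal_gibbsWeight (ω₂ := 1) (lam := 1) (β := 1) γ 3 T (fun y => dw y * a y),
      ← integral_neg]
    refine integral_congr_ae (ae_of_all _ fun y => ?_)
    simp only [hdw, ha, hb, partialP_w_flip]
    ring
  have hsum : ∀ y, a y - b y = 2 * dw y := fun y => by
    simp only [ha, hb, hdw, partialP_w_eq hs]; ring
  calc ∫ y, dw y * a y ∂(μ3 γ T)
      = ((∫ y, dw y * a y ∂(μ3 γ T)) - ∫ y, dw y * b y ∂(μ3 γ T)) / 2 := by rw [hflip]; ring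
    _ = (∫ y, (dw y * a y - dw y * b y) ∂(μ3 γ T)) / 2 := by rw [integral_sub hIa hIb]
    _ = (∫ y, 2 * (dw y) ^ 2 ∂(μ3 γ T)) / 2 := by
        congr 1
        refine integral_congr_ae (ae_of_all _ fun y => ?_)
        show dw y * a y - dw y * b y = 2 * (dw y) ^ 2
        rw [← mul_sub, hsum y]; ring
    _ = ∫ y, (dw y) ^ 2 ∂(μ3 γ T) := by rw [integral_const_mul]; ring

/-- **Strict positivity**: if `Ψ_{j_1}(s) ≠ 0` then `∫ (∂_{p_0} w_s)² e^{-H/T} > 0`. [folklore] -/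
theorem integral_sq_partialP_w_pos (γ : ℝ) {s : ℝ} (hs : 0 ≤ s) {T : ℝ} (hT : 0 < T) (hΨ : Psi j1 s ≠ 0) :
    0 < ∫ y, (partialP 0 (w s) y) ^ 2 ∂(μ3 γ T) := by
  obtain ⟨z, hz⟩ := exists_partialP_w_ne_zero hs hΨ
  have hc := continuous_partialP_w hs
  rw [integral_pos_iff_support_of_nonneg (fun y => sq_nonneg _) (integrable_sq_partialP_w γ hs hT)]
  have hopen : IsOpen (Function.support fun y => (partialP 0 (w s) y) ^ 2) := by
    rw [Function.support]
    exact isOpen_ne_fun (hc.pow 2) continuous_const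
  have hne : (Function.support fun y => (partialP 0 (w s) y) ^ 2).Nonempty := ⟨z, by simp [hz]⟩
  -- the Gibbs weight charges every non-empty open set
  haveI := isAddHaarMeasure_volume_phaseSpace 3
  have hvol : 0 < (volume : Measure (PhaseSpace 3)) (Function.support fun y => (partialP 0 (w s) y) ^ 2) :=
    hopen.measure_pos volume hne
  rw [pos_iff_ne_zero] at hvol ⊢
  intro h0
  have hρ : AEMeasurable (fun x : PhaseSpace 3 =>
      ENNReal.ofReal (Real.exp (-((pinnedChain 1 1 1 γ).hamiltonian 3 x) / T))) volume :=
    (measurable_gibbsDensity_ofReal (ω₂ := 1) (lam := 1) (β := 1) γ 3 T).aemeasurable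
  have h1 := (withDensity_apply_eq_zero' hρ).mp h0
  have hsub : (Function.support fun y => (partialP 0 (w s) y) ^ 2) ⊆
      {x : PhaseSpace 3 | ENNReal.ofReal (Real.exp (-((pinnedChain 1 1 1 γ).hamiltonian 3 x) / T)) ≠ 0} ∩
        Function.support fun y => (partialP 0 (w s) y) ^ 2 := fun x hx => by
    refine ⟨?_, hx⟩
    simp only [Set.mem_setOf_eq, ne_eq, ENNReal.ofReal_eq_zero, not_le]
    exact Real.exp_pos _
  exact hvol (measure_mono_null hsub h1)

/-- **The positive tap-leak pairing.** For `s ∈ (0, s₀]` the test function `u = w_s` (smooth, Θ-even,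
polynomially bounded) has `∫ ∂_{p_0}u⁺ · ∂_{p_0}(j_1∘Φ_s) e^{-H/T} > 0`. [folklore] -/
theorem exists_window_pairing_pos (γ : ℝ) {T : ℝ} (hT : 0 < T) :
    ∃ s₀, 0 < s₀ ∧ ∀ s ∈ Ioc 0 s₀,
      0 < ∫ y, partialP 0 (w s) y * partialP 0 (cf s) y ∂(μ3 γ T) := by
  obtain ⟨s₀, hs₀, H⟩ := exists_window_Psi_j1_ne_zero γ
  refine ⟨s₀, hs₀, fun s hs => ?_⟩
  rw [pairing_w_cf_eq γ hs.1.le hT]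
  exact integral_sq_partialP_w_pos γ hs.1.le hT (H s hs)

end Refute

/-! ## The corrector hypothesis of `P` is load-bearing -/

section Free
open MeasureTheory
open Summit.AtomisticToContinuum.FouriersLaw.Theses.OddSectorIrreversibility
open Summit.AtomisticToContinuum.FouriersLaw.Theorems.ClosedConeSensitivity.Negative.ZeroFrictionDictionary
open Summit.AtomisticToContinuum.FouriersLaw.Theorems.OddSectorIrreversibility.Corrector
open Summit.AtomisticToContinuum.FouriersLaw.Theorems.OddSectorWitness

/-- `P` WITHOUT its corrector hypothesis, at one admissible parameter point and one pair of constants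
`(a, C)`: the same bound claimed for EVERY `u ∈ C¹ ∩ L²(μ_T)` (the a.e.-limit clause
`∀ᵐ x ∂μT, Tendsto (τ ↦ ∫₀^τ P_tJ dt)(x) → u x` deleted; everything else verbatim from the route decl).
(A parametrised predicate, not a closed `Prop`.) [folklore] -/
def TapLeakPairingBoundFreeAt (ω₂ lam β γ T a C : ℝ) : Prop :=
  ∀ (N : ℕ) (i b : Fin N) (u : Literature.MathematicalPhysics.KineticTheory.HeatConduction.PhaseSpace N → ℝ) (s : ℝ), (b.val = 0 ∨ b.val = N - 1) → 0 ≤ s → let P := Literature.MathematicalPhysics.KineticTheory.HeatConduction.pinnedChain ω₂ lam β γ; let P₀ := Literature.MathematicalPhysics.KineticTheory.HeatConduction.pinnedChain ω₂ lam β 0; let μT : MeasureTheory.Measure (Literature.MathematicalPhysics.KineticTheory.HeatConduction.PhaseSpace N) := MeasureTheory.volume.withDensity (fun x : Literature.MathematicalPhysics.KineticTheory.HeatConduction.PhaseSpace N => ENNReal.ofReal (Real.exp (-(P.hamiltonian N x) / T))); let J : Literature.MathematicalPhysics.KineticTheory.HeatConduction.PhaseSpace N → ℝ := fun z => ∑ k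 : Fin N, P.bondCurrent N k z; let ue : Literature.MathematicalPhysics.KineticTheory.HeatConduction.PhaseSpace N → ℝ := fun x => (u x + u (x.1, -x.2)) / 2; let js : Literature.MathematicalPhysics.KineticTheory.HeatConduction.PhaseSpace N → ℝ := fun x => ∫ y, P.bondCurrent N i y ∂(P₀.transitionKernel N T T s.toNNReal x); let d : ℕ := (if b.val = 0 then i.val else N - 2 - i.val); ContDiff ℝ 1 u → MeasureTheory.MemLp u 2 μT → s ≤ a * (d : ℝ) → |T * ∫ x, Literature.MathematicalPhysics.KineticTheory.HeatConduction.partialP b ue x * Literature.MathematicalPhysics.KineticTheory.HeatConduction.partialP b js x ∂μT| ≤ C * Real.sqrt ((|∫ x, u x * J x ∂μT| + ∫ x, Real.exp (-(P.hamiltonian N x) / T) ∂MeasureTheory.volume) * ∫ x, Real.exp (-(P.hamiltonian N x) / T) ∂MeasureTheory.volume) / (1 + ((d : ℝ) - s / a)) ^ (3 / 2 : ℝ)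

/-- `w_s` is polynomially bounded by the energy. [folklore] -/
theorem abs_w_le (γ : ℝ) (s : ℝ) (y : PhaseSpace 3) :
    |w s y| ≤ 6 * (1 + (pinnedChain 1 1 1 γ).hamiltonian 3 y) ^ 2 := by
  have h1 : |cf s y| ≤ 6 * (1 + (pinnedChain 1 1 1 γ).hamiltonian 3 y) ^ 2 := by
    rw [cf_eq γ]
    have := abs_bondCurrent_detFlow_le (one_pos) zero_le_one zero_le_one (N := 3) γ 1 s y
    norm_num at this ⊢
    linarith
  have h2 : |cf s (y.1, -y.2)| ≤ 6 * (1 + (pinnedChain 1 1 1 γ).hamiltonian 3 y) ^ 2 := by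
    rw [cf_eq γ]
    have := abs_bondCurrent_detFlow_le (one_pos) zero_le_one zero_le_one (N := 3) γ 1 s ((y.1, -y.2) : PhaseSpace 3)
    rw [OscillatorChain.hamiltonian_neg_momentum] at this
    norm_num at this ⊢
    linarith
  unfold w
  rw [abs_div, abs_two]
  have := abs_add_le (cf s y) (cf s (y.1, -y.2))
  linarith

/-- `memLp_w` (explicit computation / helper for the third-order witness). [folklore] -/
theorem memLp_w (γ : ℝ) {s : ℝ} (hs : 0 ≤ s) {T : ℝ} (hT : 0 < T) : MemLp (w s) 2 (μ3 γ T) :=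
  memLp_two_of_abs_le_pow one_pos zero_le_one zero_le_one γ 3 hT
    (contDiff_w hs).continuous.aestronglyMeasurable 6 2 (abs_w_le γ s)

/-- `∫ w_s · J_tot dμ_T = 0` (`w_s` even, `J_tot` odd in the momenta). [folklore] -/
theorem integral_w_mul_totalCurrent (γ T s : ℝ) :
    ∫ y, w s y * (∑ k : Fin 3, (pinnedChain 1 1 1 γ).bondCurrent 3 k y) ∂(μ3 γ T) = 0 := by
  set F : PhaseSpace 3 → ℝ := fun y => w s y * (∑ k : Fin 3, (pinnedChain 1 1 1 γ).bondCurrent 3 k y) with hF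
  have hflip : ∀ y, F (y.1, -y.2) = -F y := fun y => by
    simp only [hF, w_flip, OscillatorChain.bondCurrent_neg_momentum, Finset.sum_neg_distrib]
    ring
  have hI := integral_comp_momentumReversal_gibbsWeight (ω₂ := 1) (lam := 1) (β := 1) γ 3 T F
  simp only [hflip, integral_neg] at hI
  show ∫ y, F y ∂(μ3 γ T) = 0
  linarith

/-- **For every `a > 0` and every `C` the corrector-free bound fails** at `(ω₂,lam,β,γ) = (1,1,1,1)`,
`T = 1`. Witness: contact `b = 0`, bond `i = 1` (`d = 1`), a small time `s ∈ (0, a]`, and the test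
functions `u = M·w_s`, `w_s = (j_1∘Φ_s + j_1∘Φ_s∘Θ)/2`: the left side is `M·‖∂_{p_0}w_s‖²_{L²(μ_T)} > 0`
(third-order fact + parity), the right side does not depend on `M` (`∫ u·J dμ_T = 0` by parity). [folklore] -/
theorem not_tapLeakPairingBoundFreeAt {a : ℝ} (ha : 0 < a) (C : ℝ) :
    ¬ TapLeakPairingBoundFreeAt 1 1 1 1 1 a C := by
  intro H
  obtain ⟨s₀, hs₀, Hpos⟩ := exists_window_pairing_pos 1 one_pos
  set s : ℝ := min s₀ a with hsdef
  have hs : 0 < s := lt_min hs₀ ha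
  have hss₀ : s ≤ s₀ := min_le_left _ _
  have hsa : s ≤ a := min_le_right _ _
  set π₀ : ℝ := ∫ y, partialP 0 (w s) y * partialP 0 (cf s) y ∂(μ3 1 1) with hπ₀
  have hπ : 0 < π₀ := Hpos s ⟨hs, hss₀⟩
  set Z : ℝ := ∫ x : PhaseSpace 3, Real.exp (-((pinnedChain 1 1 1 1).hamiltonian 3 x) / 1) with hZdef
  have hZ : 0 ≤ Z := integral_nonneg fun x => (Real.exp_pos _).le
  set M : ℝ := (|C| * Z + 1) / π₀ with hMdef
  have hM : 0 < M := div_pos (by positivity) hπ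
  -- the instance of the corrector-free bound
  have Hinst := H 3 1 0 (fun y => M * w s y) s (Or.inl rfl) hs.le
  have hu : ContDiff ℝ 1 (fun y : PhaseSpace 3 => M * w s y) :=
    (contDiff_const.mul (contDiff_w hs.le)).of_le (by exact_mod_cast le_top)
  have hmem : MemLp (fun y : PhaseSpace 3 => M * w s y) 2 (μ3 1 1) := (memLp_w 1 hs.le one_pos).const_mul M
  have hsd : s ≤ a * ((if (0 : Fin 3).val = 0 then (1 : Fin 3).val else 3 - 2 - (1 : Fin 3).val : ℕ) : ℝ) := by
    have : ((if (0 : Fin 3).val = 0 then (1 : Fin 3).val else 3 - 2 - (1 : Fin 3).val : ℕ) : ℝ) = 1 := by norm_num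
    rw [this, mul_one]; exact hsa
  have Hi := Hinst hu hmem hsd
  -- identify the pieces
  have hjs : (fun x : PhaseSpace 3 => ∫ y, (pinnedChain 1 1 1 1).bondCurrent 3 1 y
      ∂((pinnedChain 1 1 1 0).transitionKernel 3 1 1 s.toNNReal x)) = cf s := by
    funext x
    rw [integral_transitionKernel_zero_friction one_pos zero_le_one zero_le_one, cf_eq 1]
    simp only [Real.coe_toNNReal _ hs.le]
  have hue : (fun x : PhaseSpace 3 => (M * w s x + M * w s (x.1, -x.2)) / 2) = fun x => M * w s x := by
    funext x; rw [w_flip]; ring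
  have hLHS : ∫ x, partialP 0 (fun x : PhaseSpace 3 => (M * w s x + M * w s (x.1, -x.2)) / 2) x *
      partialP 0 (fun x : PhaseSpace 3 => ∫ y, (pinnedChain 1 1 1 1).bondCurrent 3 1 y
        ∂((pinnedChain 1 1 1 0).transitionKernel 3 1 1 s.toNNReal x)) x ∂(μ3 1 1) = M * π₀ := by
    rw [hjs, hue, hπ₀, ← integral_const_mul]
    refine integral_congr_ae (ae_of_all _ fun x => ?_)
    show partialP 0 (fun x : PhaseSpace 3 => M * w s x) x * partialP 0 (cf s) x = M * (partialP 0 (w s) x * partialP 0 (cf s) x)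
    rw [show partialP 0 (fun x : PhaseSpace 3 => M * w s x) x = M * partialP 0 (w s) x from by
      unfold partialP; exact deriv_const_mul_field M]
    ring
  have hUJ : ∫ x, (M * w s x) * (∑ k : Fin 3, (pinnedChain 1 1 1 1).bondCurrent 3 k x) ∂(μ3 1 1) = 0 := by
    have := integral_w_mul_totalCurrent 1 1 s
    calc ∫ x, (M * w s x) * (∑ k : Fin 3, (pinnedChain 1 1 1 1).bondCurrent 3 k x) ∂(μ3 1 1)
        = M * ∫ x, w s x * (∑ k : Fin 3, (pinnedChain 1 1 1 1).bondCurrent 3 k x) ∂(μ3 1 1) := by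
          rw [← integral_const_mul]; refine integral_congr_ae (ae_of_all _ fun x => ?_); ring
      _ = 0 := by rw [this, mul_zero]
  dsimp only [μ3, gibbsWeight] at hLHS hUJ
  -- rewrite the instance
  have Hi' : |1 * (M * π₀)| ≤ C * Real.sqrt ((|(0 : ℝ)| + Z) * Z) / (1 + ((1 : ℝ) - s / a)) ^ (3 / 2 : ℝ) := by
    have e1 : ((if (0 : Fin 3).val = 0 then (1 : Fin 3).val else 3 - 2 - (1 : Fin 3).val : ℕ) : ℝ) = 1 := by norm_num
    simp only [] at Hi
    rw [hLHS, hUJ, e1] at Hi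
    exact Hi
  -- the right side does not exceed `|C| Z`
  have hbase : 1 ≤ 1 + ((1 : ℝ) - s / a) := by
    have : s / a ≤ 1 := (div_le_one ha).mpr hsa
    linarith
  have hD : 1 ≤ (1 + ((1 : ℝ) - s / a)) ^ (3 / 2 : ℝ) := Real.one_le_rpow hbase (by norm_num)
  have hsqrt : Real.sqrt ((|(0 : ℝ)| + Z) * Z) = Z := by rw [abs_zero, zero_add, Real.sqrt_mul_self hZ]
  rw [hsqrt] at Hi'
  have hR : C * Z / (1 + ((1 : ℝ) - s / a)) ^ (3 / 2 : ℝ) ≤ |C| * Z := by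
    have hDpos : 0 < (1 + ((1 : ℝ) - s / a)) ^ (3 / 2 : ℝ) := by positivity
    calc C * Z / (1 + ((1 : ℝ) - s / a)) ^ (3 / 2 : ℝ) ≤ |C| * Z / (1 + ((1 : ℝ) - s / a)) ^ (3 / 2 : ℝ) := by
          gcongr; exact le_abs_self C
      _ ≤ |C| * Z := div_le_self (by positivity) hD
  have hL : |1 * (M * π₀)| = |C| * Z + 1 := by
    rw [one_mul, abs_of_pos (mul_pos hM hπ), hMdef, div_mul_cancel₀ _ hπ.ne']
  linarith [hL ▸ Hi', hR]

/-- **The corrector hypothesis of `P` is load-bearing**: deleting the a.e.-limit clause (keeping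
`u ∈ C¹ ∩ L²(μ_T)` and everything else) makes the statement false. [folklore] -/
theorem tapLeakBound_false_without_corrector :
    ¬ (∀ ω₂ lam β γ : ℝ, 0 < ω₂ → 0 < lam → 0 < β → 0 < γ → ∀ T : ℝ, 0 < T →
        ∃ a C : ℝ, 0 < a ∧ TapLeakPairingBoundFreeAt ω₂ lam β γ T a C) := by
  intro h
  obtain ⟨a, C, ha, H⟩ := h 1 1 1 1 one_pos one_pos one_pos one_pos 1 one_pos
  exact not_tapLeakPairingBoundFreeAt ha C H

end Free




end N3

/-- `P` with its corrector hypothesis (the a.e.-limit clause) DROPPED, everything else verbatim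
(cdisprove protocol: `<CruxDecl>Without<H>`). -/
def TapLeakBoundWithoutCorrector : Prop :=
  ∀ ω₂ lam β γ : ℝ, 0 < ω₂ → 0 < lam → 0 < β → 0 < γ → ∀ T : ℝ, 0 < T →
    ∃ a C : ℝ, 0 < a ∧ N3.TapLeakPairingBoundFreeAt ω₂ lam β γ T a C

/-- The dropped-hypothesis variant implies `P` (it is `P` minus one hypothesis). -/
theorem tapLeakBound_of_withoutCorrector (h : TapLeakBoundWithoutCorrector) : TapLeakBound := by
  intro ω₂ lam β γ hω hl hβ hγ T hT
  obtain ⟨a, C, ha, H⟩ := h ω₂ lam β γ hω hl hβ hγ T hT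
  refine ⟨a, C, ha, fun N i b u s hb hs => ?_⟩
  intro P P₀ μT J ue js d hu hmem _ hsd
  exact H N i b u s hb hs hu hmem hsd

/-- **Any proof of `P` must use that `u` is the corrector** (`¬ TapLeakBoundWithoutCorrector`, PROVED:
third-order witness on the anharmonic 3-chain, `N3.not_tapLeakPairingBoundFreeAt`). -/
theorem tapLeakBound_false_without_corrector : ¬ TapLeakBoundWithoutCorrector := fun h => by
  obtain ⟨a, C, ha, H⟩ := h 1 1 1 1 one_pos one_pos one_pos one_pos 1 one_pos
  exact N3.not_tapLeakPairingBoundFreeAt ha C H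

end Summit.AtomisticToContinuum.FouriersLaw.Cruxes.TapLeakBound.Disproof

end
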